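import Literature.MathematicalPhysics.QuantumFieldTheory.Balaban1983to89.Node00.Record13
import Literature.MathematicalPhysics.QuantumFieldTheory.Balaban1983to89.Node00.Record12BgRowMixed
import Literature.MathematicalPhysics.QuantumFieldTheory.Balaban1983to89.Node00.Record12BgRowCoDiv

/-!
# NODE 00 (YM-PLAN Track A) — RECORD 13, §10 (v1.3): ROW P11 ON PRINT'S SEQUENCES, PARTITION-COMPATIBLE RUNS AND PRINT'S (7)-REGULAR DATA —
# the `SepMixed` range of `Node00/Record13.lean` (deprecate-and-add successor of §9's `Sep` range), AS A SIBLING MODULE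

This module IS §10 of RECORD 13 (node00-def-T lineage, v1.3, 2026-08-27; director-ym LINE №141 ∕ №142 RULING ρ1-SEQUENCED; node00-def-P11
LOCATED-P11-MIXED-SUPPORT + `Node00/Record12BgRowMixed.lean` (`Sect2.DataSmall7P`, cited BY NAME); dag-lead DEDUP-257 ∕ 258; plan g67 ρ1).  It is
filed as a sibling of `Node00/Record13.lean` and not inside it for ONE mechanical reason: the gate caps a target file at 200 000 bytes and RECORD 13
v1.2 is 174 915 bytes; §10 (≈ 62 000 bytes) does not fit (propose AND patch lane answer «content exceeds 200000 bytes»).  Nothing else changes: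
same namespace (every declaration below has exactly the name announced in INTENT-20, `…Node00.<decl>`), same shape as §9, `Node00/Record13.lean`
v1.2 UNTOUCHED (not a byte of a landed body or statement is edited — gate5 D-0009), and the deprecation of `Stage13Params.Provisos₁₃Sep` is the
sentence below plus the bus KEY line (token map `…Sep ↦ …SepMixed`, module `…Node00.Record13` ↦ `…Node00.Record13SepMixed` for the re-keyed names).

v1.3 ADDS (π), editing no landed body: the support CUT DOWN ONCE MORE to print's (7)-regular data `suppOfRecord₁₃SepMixed θ p n s :=
{W ∈ suppOfRecord₁₃ θ p n s | Sect2.SeqSeparated θ.ν.M₁ s ∧ (7)-regularity of W}` ([15] (7) p. 278 with the `V ∕ V̄` rule, node00-def-P11's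
`Sect2.DataSmall7P`; LOCATED-P11-MIXED-SUPPORT: v1.2's support admits cross-scale-twisted data print excludes, so row `bg` over it is plausibly
uninhabited); `Stage13Params.Provisos₁₃SepMixed` = `Provisos₁₃Sep` verbatim except `bg` over `suppOfRecord₁₃SepMixed`; `Provisos₁₃Sep.toSepMixed`;
the tower ∕ datum `towerOfRecord₁₃SepMixed` ∕ `datumOfRecord₁₃SepMixed` keyed on the SAME core (`towerOfRecord₁₃Core` ∕ `datumOfRecord₁₃Core`, §9) with `rfl`
bridges; and the complete `SepMixed`-keyed twin family of §9 (one reader of the new row: `norm_E_bg_le_stage13SepMixed`).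

DEPRECATION (v1.3): `Stage13Params.Provisos₁₃Sep` (RECORD 13 §9) demands row `bg` over the separated support `suppOfRecord₁₃Sep`, which admits
cross-scale-twisted data that print's (7) [15] p. 278 excludes; its successor for every consumer is `Stage13Params.Provisos₁₃SepMixed` below.  §9 is
kept verbatim in `Node00/Record13.lean`; every v1.2 record is a v1.3 record (`IsRecordOfRecord₁₃CSep.toSepMixed`).

HYP-AUDIT-13 (director-ym №142 (S2); owners node00-def-P11 × dag-ref-G; merged table 2026-08-27, 0 MISSING rows un-dispositioned) AS IT BEARS ON THIS
MODULE.  Guards of the support = ⟨regular support, `Sect2.SeqSeparated θ.ν.M₁ s` (R = L; [15] (1) ∕ [6] (1.4) «R ≥ R₁ a power of L» — LOCATED №5: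
faithful iff `R₁ ≤ L`, displayed in the named fact's docstring, not a field), `Sect2.DataSmall7P` ([15] (7) p. 278 with the `V ∕ V̄` rule on
print's range, H6∕H7), `Sect2.CoDivClassOn` at the record minimiser `UbgMSOfRecord … s W` (H4∕№6: [6] (1.9), director-ym №143∕№144 (a), def-R's locus)⟩;
the run antecedent `PartCompat₁₃` as in v1.2 (H17∕R8; director-ym №147 (F1′): NO run-level `c2` field — a θ-level ∀ over windowed runs would type
the record empty); TWO θ-level fields `hM : ∃ a, θ.τ9.M = F.L ^ a` ([III] p. 245 «M = L^m»; tribunal J TRIB-J-Q1 ∕ director-ym №145: kills the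
`4 ∣ M` PartCompat dodge — `Provisos₁₃SepMixed.not_four_dvd_M`) and `hM₁ : θ.ν.M₁ ∣ θ.τ9.M` (H1, run-free; `Provisos₁₃SepMixed.M₁_dvd_dCubeSide` gives
«M₁ ∣ M·R_j» at every 𝐃_j-cube); numerics LETTERS owed to the family's
docstring, not fields: «c_R ≥ 2(1 + 6(d+2)²)» (R5), «q₀ ≥ 2» (H18); LOCATED №5 (R ≥ R₁) logged; CONFIRMs owed
later by def-R (H4 class, H9 covariance, R7 localisation) and by the K1 lane (R9 χ ⇒ guards) — none a field here.  ONE WEIGHT FAMILY (director-ym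
№146, disposition (α)): NO junction letter between `θ.ν.εreg` — the run-FREE radius of the (2.12) regularity class read by `UbgMSOfRecord`, the [15] faces
and the (1.9) guard above — and the run-DEPENDENT threshold letters of `Node00/StepWeightsAtThresholds.lean` (`epsLetterOfRecord`, [III] (2.4)) is typed
here: a two-sided θ-level comparability is false on deep runs (`ε_j → 0`), a one-sided one mixes print-explicit with print-implicit constants; the junction
is a constructor choice (the K0 witness draws `εreg`), and an untyped record-level junction is the declared reason for a possible later revision
(a currency change of the class objects, owned by their declarers), not a defect of this module.

HONEST POSTURE.  Definitions and `rfl` ∕ one-line bridges only; no estimate of Bałaban is asserted; the (7)-regularity predicate is node00-def-P11's,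
cited by name, not restated; no node count moves (typed 28∕28 · discharged 5∕28); RIDER №7: N-generic (`[NeZero N]`), no K0 stated here.  One finite
four-torus programme at fixed `ε = L^{−K}` — NOT the continuum limit on ℝ⁴, NOT infinite volume, NOT OS, NOT a mass gap, NOT the Clay problem.
-/

noncomputable section

open MeasureTheory
open scoped Matrix.Norms.L2Operator

namespace Literature.MathematicalPhysics.QuantumFieldTheory.Balaban1983to89.Node00

open T4Continuum AveragingRT T4FiniteEpsInhabited FlowStep FlowStepRuns DagBinding T4DatumAssembly
open B12Eq019ActionBody (integrand)

variable (F : T4Family) (N : ℕ) [NeZero N]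

/-! ## §10 (v1.3). ROW P11 ON PRINT'S SEQUENCES, PARTITION-COMPATIBLE RUNS AND PRINT'S (7)-REGULAR DATA: the support `suppOfRecord₁₃SepMixed`,
the displayed provisos `Provisos₁₃SepMixed` (deprecate-and-add successor of `Provisos₁₃Sep`), the tower ∕ datum RE-KEYED on the same core with `rfl`
bridges, and the twin face family — every §9 statement VERBATIM with `Sep ↦ SepMixed` -/

section MixedRange

/-- **THE SUPPORT OF ROW P11 ON PRINT'S SEQUENCES AND PRINT'S DATA** (v1.3; node00-def-P11 LOCATED-P11-MIXED-SUPPORT, director-ym №141∕№142,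
dag-lead DEDUP-257, plan g67 ρ1): §9's separated support `suppOfRecord₁₃Sep` CUT DOWN ONCE MORE to the data `W` that are REGULAR IN PRINT'S SENSE
[15] (7) p. 278 — on every plaquette `p′` touching `Λ_{m+1}` the MIXED plaquette variable built with the `V ∕ V̄` rule (bonds off `Λ_{m+1}` carry the
one-step average of the finer datum) is within `c_R·ε_{m+1}` of `1` (node00-def-P11's `Sect2.DataSmall7P`, the Literature-side twin of print's clause,
on PRINT'S RANGE `Sect2.printedPlaqs` = the level-`j` plaquettes touching `Γ_j` none of whose four bonds has both endpoints in `Ω_{j+1}` — HYP-AUDIT-13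
H6 CONCORD node00-def-P11 × dag-ref-G × dag-ref-C: level 0 keeps every all-bonds-pinned plaquette, levels ≥ 1 read `W (m+1)` on `Λ`-bonds and `V̄` on outer
bonds and never a bond inside `Ω_{m+2}`, where print defines nothing; [III] p. 256 «we assume that the field V_{j−1} is
regular on Γ_{j−1}» read with [15]'s convention); AND (director-ym №143∕№144 (a) with node00-def-R's correction, HYP-AUDIT-13 H4∕№6) whose RECORD MINIMISER
`UbgMSOfRecord … n s W` (node00-def-R FILE 16; `= UbgOfRecord₁₃ θ p n s W` at every `n ≥ 1`, `UbgOfRecord₁₃_succ` — the object row `bg` reads) lies in the (1.9) CO-DIVERGENCE half of [6]'s regular class `𝔄_n({Ω_j}, εreg)` at every scale `j ≤ n`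
(node00-def-P11's `Sect2.CoDivClassOn`, [6] (1.9) p. 77 with (1.1)–(1.2) p. 76; print's [15] Thm 1 minimises over the class (2) = (1.7) ∧ (1.9), so
without this member row `bg` would be print-STRONGER by exactly (1.9) — a CLASS condition read at the minimiser, never a condition on the datum).  Membership = `⟨regular support, separation,
(7)-regularity, (1.9) co-divergence class OF THE RECORD'S MINIMISER⟩`, in this order.  A SUPPORT GUARD of the same (T1)-shape as v1.2's: a proviso over it demands nothing at data print excludes.
[cite: Balaban1985RegularSpaces, (7) p.278, (1.3)–(1.6) p.77; Balaban1988Convergent, (2.1) p.254, (2.28) p.259] -/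
def suppOfRecord₁₃SepMixed (θ : Stage13Params F N) (p : B12.RunParams) (n : ℕ)
    (s : SeqOfRecord F θ.ν θ.τ9.M (gOfRecord₁₃ F N θ p) p.K n) : Set (B15DeterminingSets.MSField (F.P p.K) (SU N)) :=
  {W | W ∈ suppOfRecord₁₃ F N θ p n s ∧ Sect2.SeqSeparated θ.ν.M₁ s ∧ Sect2.DataSmall7P (avOfRecord F N p.K) s.Ω n (fun j => θ.s2.cR * epsOfRecord θ.ν (gOfRecord₁₃ F N θ p) j) W ∧
      Sect2.CoDivClassOn s.Ω n θ.ν.εreg (UbgMSOfRecord F N θ.ν θ.τ9.M (gOfRecord₁₃ F N θ p) p.K n s W)}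

/-- Membership in the separated (7)-regular support, read off (`Iff.rfl`). [cite: Balaban1988Convergent, (2.28) p.259 (bookkeeping)] -/
theorem mem_suppOfRecord₁₃SepMixed_iff (θ : Stage13Params F N) (p : B12.RunParams) (n : ℕ)
    (s : SeqOfRecord F θ.ν θ.τ9.M (gOfRecord₁₃ F N θ p) p.K n) (W : B15DeterminingSets.MSField (F.P p.K) (SU N)) :
    W ∈ suppOfRecord₁₃SepMixed F N θ p n s ↔
      W ∈ suppOfRecord₁₃ F N θ p n s ∧ Sect2.SeqSeparated θ.ν.M₁ s ∧ Sect2.DataSmall7P (avOfRecord F N p.K) s.Ω n (fun j => θ.s2.cR * epsOfRecord θ.ν (gOfRecord₁₃ F N θ p) j) W ∧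
        Sect2.CoDivClassOn s.Ω n θ.ν.εreg (UbgMSOfRecord F N θ.ν θ.τ9.M (gOfRecord₁₃ F N θ p) p.K n s W) :=
  Iff.rfl

/-- The separated (7)-regular support lies in the separated support of v1.2. [cite: Balaban1988Convergent, (2.28) p.259 (bookkeeping)] -/
theorem suppOfRecord₁₃SepMixed_subset_sep (θ : Stage13Params F N) (p : B12.RunParams) (n : ℕ)
    (s : SeqOfRecord F θ.ν θ.τ9.M (gOfRecord₁₃ F N θ p) p.K n) : suppOfRecord₁₃SepMixed F N θ p n s ⊆ suppOfRecord₁₃Sep F N θ p n s :=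
  fun _ hW => ⟨hW.1, hW.2.1⟩

/-- The separated (7)-regular support lies in §2's support of record. [cite: Balaban1988Convergent, (2.28) p.259 (bookkeeping)] -/
theorem suppOfRecord₁₃SepMixed_subset (θ : Stage13Params F N) (p : B12.RunParams) (n : ℕ)
    (s : SeqOfRecord F θ.ν θ.τ9.M (gOfRecord₁₃ F N θ p) p.K n) : suppOfRecord₁₃SepMixed F N θ p n s ⊆ suppOfRecord₁₃ F N θ p n s :=
  fun _ hW => hW.1

/-- At a NON-separated index the separated (7)-regular support is EMPTY. [cite: Balaban1985RegularSpaces, (1.3)–(1.6) p.77 (bookkeeping)] -/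
theorem suppOfRecord₁₃SepMixed_eq_empty_of_not_seqSeparated (θ : Stage13Params F N) (p : B12.RunParams) (n : ℕ)
    {s : SeqOfRecord F θ.ν θ.τ9.M (gOfRecord₁₃ F N θ p) p.K n} (hs : ¬ Sect2.SeqSeparated θ.ν.M₁ s) :
    suppOfRecord₁₃SepMixed F N θ p n s = ∅ :=
  Set.eq_empty_of_forall_notMem fun _ hW => hs hW.2.1

/-- The TRIVIAL datum `W = 1` lies in the separated (7)-regular support at a separated index, GIVEN its (7)-regularity and the (1.9) class membership of its record minimiser (displayed).
[cite: Balaban1985RegularSpaces, (7) p.278; Balaban1988Convergent, (2.1) p.254 (bookkeeping)] -/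
theorem one_mem_suppOfRecord₁₃SepMixed (θ : Stage13Params F N) (hθ : θ.Pos₁₂ F N) (p : B12.RunParams) (n : ℕ)
    (hε : ∀ j ≤ n, 0 < epsOfRecord θ.ν (gOfRecord₁₃ F N θ p) j)
    {s : SeqOfRecord F θ.ν θ.τ9.M (gOfRecord₁₃ F N θ p) p.K n} (hs : Sect2.SeqSeparated θ.ν.M₁ s)
    (h7 : Sect2.DataSmall7P (avOfRecord F N p.K) s.Ω n (fun j => θ.s2.cR * epsOfRecord θ.ν (gOfRecord₁₃ F N θ p) j) (1 : B15DeterminingSets.MSField (F.P p.K) (SU N)))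
    (h9 : Sect2.CoDivClassOn s.Ω n θ.ν.εreg (UbgMSOfRecord F N θ.ν θ.τ9.M (gOfRecord₁₃ F N θ p) p.K n s (1 : B15DeterminingSets.MSField (F.P p.K) (SU N)))) :
    (1 : B15DeterminingSets.MSField (F.P p.K) (SU N)) ∈ suppOfRecord₁₃SepMixed F N θ p n s :=
  ⟨one_mem_suppOfRecord₁₃ F N θ hθ p n hε s, hs, h7, h9⟩

variable {F N} in
/-- Transfer: a background proviso granted over §2's WHOLE support holds over the separated (7)-regular one (def-R `BgProvisoΛ.mono`).
[cite: Balaban1988Convergent, (2.28) p.259 (bookkeeping)] -/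
theorem bgProvisoΛ_suppOfRecord₁₃SepMixed_of_suppOfRecord₁₃ {θ : Stage13Params F N} {p : B12.RunParams} {n k : ℕ}
    {U : SeqOfRecord F θ.ν θ.τ9.M (gOfRecord₁₃ F N θ p) p.K n → BgMap F N p.K}
    (h : BgProvisoΛ F N p.K (settingOfRecord₁₃ F N θ p) (θ.Rz p.K) θ.τ9.M k (suppOfRecord₁₃ F N θ p n) U) :
    BgProvisoΛ F N p.K (settingOfRecord₁₃ F N θ p) (θ.Rz p.K) θ.τ9.M k (suppOfRecord₁₃SepMixed F N θ p n) U :=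
  h.mono fun s => suppOfRecord₁₃SepMixed_subset F N θ p n s

variable {F N} in
/-- Transfer: a background proviso granted over v1.2's SEPARATED support holds over the separated (7)-regular one (def-R `BgProvisoΛ.mono`).
[cite: Balaban1988Convergent, (2.28) p.259 (bookkeeping)] -/
theorem bgProvisoΛ_suppOfRecord₁₃SepMixed_of_suppOfRecord₁₃Sep {θ : Stage13Params F N} {p : B12.RunParams} {n k : ℕ}
    {U : SeqOfRecord F θ.ν θ.τ9.M (gOfRecord₁₃ F N θ p) p.K n → BgMap F N p.K}
    (h : BgProvisoΛ F N p.K (settingOfRecord₁₃ F N θ p) (θ.Rz p.K) θ.τ9.M k (suppOfRecord₁₃Sep F N θ p n) U) :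
    BgProvisoΛ F N p.K (settingOfRecord₁₃ F N θ p) (θ.Rz p.K) θ.τ9.M k (suppOfRecord₁₃SepMixed F N θ p n) U :=
  h.mono fun s => suppOfRecord₁₃SepMixed_subset_sep F N θ p n s

/-- **THE DISPLAYED PROVISOS at `θ : Stage13Params`, Stage 13, ROW P11 ON PRINT'S SEQUENCES** (v1.2 — the deprecate-and-add SUCCESSOR of `Provisos₁₃`,
director-ym №138): the ten rows of `Provisos₁₃` VERBATIM except that row `bg` demands def-R's ranged background proviso `BgProvisoΛ` over the SEPARATED
support `suppOfRecord₁₃SepMixed` — i.e. only at (2.18) indices `s` separated in the sense of [6] (1.3)–(1.6) (`Sect2.SeqSeparated θ.ν.M₁ s`), the sequences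
print's [15] Theorem 1 ∕ (2.7) speak of; at every other index the support is empty — and only along runs `(p, n)` whose 𝐃_j-partitions are
compatible with the torus (`PartCompat₁₃`, the second antecedent; plan g67 WORD-T2, [III] p. 257).  Same field names and order (structure-instance re-keying is 1:1;
`Provisos₁₃.toSepMixed`).  Rows `intPiece` ∕ `measω` ∕ `measChi` ∕ `rstep` remain THEOREMS of (H-U) and the ζ-laws (§4c, unchanged); the comparability of
thresholds `ε_m ≤ 2ε_{m+1}` and the monotonicity of the history are NOT displayed here (theorems ∕ stubs of the row's suppliers).  HYPOTHESES,
never admissibility clauses, never asserted. [cite: Balaban1988Convergent, (2.1) p.254, (2.7) p.255, p.256, (2.18) p.257, (2.21) p.258, (2.28) p.259, (3.2)–(3.9) pp.265–266, (3.16) p.268, (3.20)–(3.21) p.269; Balaban1985RegularSpaces, (1.3)–(1.6) p.77; Balaban1985Variational, Thm 1 (8) p.279; Balaban1989LargeFieldI, (0.3)–(0.4) p.176; Balaban1987RG1, (0.13) p.254, (0.19) p.255, p.259, (1.2) p.260] -/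
structure Stage13Params.Provisos₁₃SepMixed (θ : Stage13Params F N) : Prop where
  /-- the level-`k` pieces `χ_k(s)·slot_k(s)` of `ρ_k` are integrable, `k < K`, along the ₁₃ histories -/
  intPiece : ∀ (p : B12.RunParams) (k : ℕ), k < p.K → ∀ s : SeqOfRecord F θ.ν θ.τ9.M (gOfRecord₁₃ F N θ p) p.K k,
    Integrable (fun U => chiSeqOfRecord F N θ.ν θ.τ9.M (gOfRecord₁₃ F N θ p) p.K k s U *
      slotsOfRecord F N θ.ν θ.τ9 (EOfRecord₁₃ F N θ) (wOfRecord₉ F N θ.toStage9Params) θ.ppSel p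
        (gOfRecord₁₃ F N θ p) k s U) (fieldMeasure (F.P p.K) k (SU N))
  /-- (O4): the label weights `ω = a·b·ζ` are jointly measurable in `(V′, U)`, `k < K`, along the ₁₃ histories -/
  measω : ∀ (p : B12.RunParams) (k : ℕ), k < p.K → ∀ (s : SeqOfRecord F θ.ν θ.τ9.M (gOfRecord₁₃ F N θ p) p.K k)
    (t : LbOfRecord F θ.ν p (gOfRecord₁₃ F N θ p) k),
    Measurable (fun z : GaugeField (F.P p.K) (k + 1) (SU N) × GaugeField (F.P p.K) k (SU N) =>
      ωOfRecord F N θ.ν θ.τ9.M p (gOfRecord₁₃ F N θ p) k θ.A₁ θ.ζ s t z.2 z.1)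
  /-- the new front factors `χ_{k+1}(s′)` are measurable, `k < K`, along the ₁₃ histories -/
  measChi : ∀ (p : B12.RunParams) (k : ℕ), k < p.K → ∀ s' : SeqOfRecord F θ.ν θ.τ9.M (gOfRecord₁₃ F N θ p) p.K (k + 1),
    Measurable (chiSeqOfRecord F N θ.ν θ.τ9.M (gOfRecord₁₃ F N θ p) p.K (k + 1) s')
  /-- the residual `ζ` resolves unity -/
  zetaUnity : IsZetaUnity F N θ.ν θ.τ9.M θ.ζ
  /-- the residual `ζ` has `Σ |ζ| ≤ 1` -/
  zetaAbs : IsZetaAbsLeOne F N θ.ν θ.τ9.M θ.ζ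
  /-- def-R's (0.3) provisos of the pre-𝐑 tower of record, INTEGRABLE FORM (`RepData.ProvisosInt`), at every level `k+1 ≤ K`, along the ₁₃ histories, at
  every instance -/
  rstep : ∀ (p : B12.RunParams) (k : ℕ) [DecidableEq (PBond (F.P p.K) (k + 1))], k < p.K →
    (towerRepOfRecord F N θ.ν θ.τ9 (slotsTOfRecord F N θ.ν θ.τ9 (EOfRecord₁₃ F N θ) (wOfRecord₉ F N θ.toStage9Params) θ.ppSel)
      θ.ppSel p (gOfRecord₁₃ F N θ p) (k + 1)).toRepData.ProvisosInt
  /-- 11c's laws of the residual §2 data -/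
  rzLaws : ∀ K, (θ.Rz K).Laws
  /-- 12a's law of the residual part of the 𝐓-weights: `ζ0 ≥ 0` -/
  ztLaws : ∀ K, (θ.Zt K).Laws
  /-- the locality law of the residual 𝐓-weight factor -/
  ztLocal : ∀ K, (θ.Zt K).LocalLaws
  /-- [III] p. 245 «M = L^m is sufficiently large»: the 𝐑-operation cube side `M` is a POWER OF `L` (θ-level letter of print; tribunal J
  TRIB-J-Q1 2026-08-27: with `Odd L` it excludes `4 ∣ M`, under which `PartCompat₁₃ θ p n` fails for every `n ≥ 1` and row `bg` idles) -/
  hM : ∃ a : ℕ, θ.τ9.M = F.L ^ a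
  /-- [III] p. 245 «M₁ = L^{m₁}, M₂ = L^{m₂}, M₁ < M₂ < M» read as the DIVISIBILITY letter H1 of HYP-AUDIT-13 (director-ym №145 (F2)): the layer width `M₁`
  of the (2.13) determining sets divides the 𝐑-cube side `M`, hence every 𝐃_j-cube side `L^j·M·R_j` — so `Ω_j`, `Λ_j ∈ 𝐃_j` are unions of the
  `M₁L^jη`-blocks of [15] (1) ∕ [6] (1.4) (θ-level, run-free; `M₁_dvd_dCubeSide`) -/
  hM₁ : θ.ν.M₁ ∣ θ.τ9.M
  /-- p. 259, ON PRINT'S RANGES AND PRINT'S SEQUENCES (v1.3; v1.2: def-R's `BgProvisoΛ` over the SEPARATED support `suppOfRecord₁₃SepMixed`): def-R's background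
  of record lies in `U^c_j(X, α_{0,j}, α_{1,j})` for the domains `X ⊂ Λ_j(s)` of the (2.26)–(2.27) ∕ (2.30) sums and in `Ũ^c_j(X)` for the domains of
  the (2.41)(i) range, on the regular retained configurations AT SEPARATED (2.18) indices `s` ([6] (1.3)–(1.6)) — every run whose ₁₃ history stays in
  the window `]0, γ]` up to the length `n ≤ K` AND whose 𝐃_j-partitions, `1 ≤ j ≤ n`, are compatible with the torus ([III] p. 257; `PartCompat₁₃`, plan WORD-T2) -/
  bg : ∀ (p : B12.RunParams) (n : ℕ), n ≤ p.K → Step.InInterval θ.γ n (gOfRecord₁₃ F N θ p) → PartCompat₁₃ F N θ p n →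
    BgProvisoΛ F N p.K (settingOfRecord₁₃ F N θ p) (θ.Rz p.K) θ.τ9.M n (suppOfRecord₁₃SepMixed F N θ p n) (UbgOfRecord₁₃ F N θ p n)
  /-- **(H-ζ) ROW** (v1.8 · director-ym №228 LOCATED-ζ · plan g87 S2-FULL): the residual fluctuation factor `ζ` of the record is jointly
  measurable in the old and new fields — the displayed bookkeeping proviso `ZetaMeasurable` (RECORD 12 measurability), until v1.7 threaded
  as a separate hypothesis `hζ`, now a ROW of every Stage-13 proviso edition.  A REAL, REQUIRED field (readers: `h.zetaMeas`); the `autoParam`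
  default below only FILLS it at a construction site that omits it — from a Stage-13 proviso value of ANY edition already in hand (the
  transports ∕ doors) or from an `hζ` in context (the from-scratch selectors) — and fails loudly with the goal displayed otherwise.
  HYPOTHESIS, never an admissibility clause, never asserted. [cite: Balaban1988Convergent, (3.16) p.268, (3.20)–(3.21) p.269 (bookkeeping)] -/
  zetaMeas : ZetaMeasurable F N θ.ζ := by
    first
      | (have h' := ‹_root_.Literature.MathematicalPhysics.QuantumFieldTheory.Balaban1983to89.Node00.Stage13Params.Provisos₁₃ _ _ _›; exact h'.zetaMeas)
      | (have h' := ‹_root_.Literature.MathematicalPhysics.QuantumFieldTheory.Balaban1983to89.Node00.Stage13Params.Provisos₁₃Core _ _ _›; exact h'.zetaMeas)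
      | (have h' := ‹_root_.Literature.MathematicalPhysics.QuantumFieldTheory.Balaban1983to89.Node00.Stage13Params.Provisos₁₃Sep _ _ _›; exact h'.zetaMeas)
      | (have h' := ‹_root_.Literature.MathematicalPhysics.QuantumFieldTheory.Balaban1983to89.Node00.Stage13Params.Provisos₁₃SepCo _ _ _›; exact h'.zetaMeas)
      | (have h' := ‹_root_.Literature.MathematicalPhysics.QuantumFieldTheory.Balaban1983to89.Node00.Stage13Params.Provisos₁₃SepMixed _ _ _›; exact h'.zetaMeas)
      | (have h' := ‹_root_.Literature.MathematicalPhysics.QuantumFieldTheory.Balaban1983to89.Node00.Stage13Params.Provisos₁₃SepCoP _ _ _›; exact h'.zetaMeas)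
      | (have h' := ‹_root_.Literature.MathematicalPhysics.QuantumFieldTheory.Balaban1983to89.Node00.Stage13RParams.Provisos₁₃CoPR _ _ _›; exact h'.zetaMeas)
      | (have h' := ‹_root_.Literature.MathematicalPhysics.QuantumFieldTheory.Balaban1983to89.Node00.Stage13RParams.Provisos₁₃SepCoPR _ _ _›; exact h'.zetaMeas)
      | (have h' := ‹_root_.Literature.MathematicalPhysics.QuantumFieldTheory.Balaban1983to89.Node00.Stage13HParams.Provisos₁₃CoPH _ _ _›; exact h'.zetaMeas)
      | (have h' := ‹_root_.Literature.MathematicalPhysics.QuantumFieldTheory.Balaban1983to89.Node00.Stage13HParams.Provisos₁₃SepCoPH _ _ _›; exact h'.zetaMeas)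
      | assumption

variable {F N}

/-- The separated-range provisos PROJECT to the core (drop `bg`). [cite: Balaban1988Convergent, (2.18) p.257 (bookkeeping)] -/
theorem Stage13Params.Provisos₁₃SepMixed.toCore {θ : Stage13Params F N} (h : θ.Provisos₁₃SepMixed F N) : θ.Provisos₁₃Core F N where
  intPiece := h.intPiece
  measω := h.measω
  measChi := h.measChi
  zetaUnity := h.zetaUnity
  zetaAbs := h.zetaAbs
  rstep := fun p k _ hk => h.rstep p k hk
  rzLaws := h.rzLaws
  ztLaws := h.ztLaws
  ztLocal := h.ztLocal

/-- (v1.3 pin, tribunal J TRIB-J-Q1 ∕ director-ym №145 (F3)) **`M` IS ODD**: `M = L^a` with `L` odd (`T4Family.hL`).  [cite: Balaban1988Convergent, p.245 (bookkeeping)] -/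
theorem Stage13Params.Provisos₁₃SepMixed.odd_M {θ : Stage13Params F N} (h : θ.Provisos₁₃SepMixed F N) : Odd θ.τ9.M := by
  obtain ⟨a, ha⟩ := h.hM
  rw [ha]
  exact F.hL.1.pow

/-- (v1.3 pin, director-ym №145 (F3)) **THE ANTI-DODGE CERTIFICATE `¬ 4 ∣ M`**: the junk numerics `M := 4` under which `PartCompat₁₃ θ p n` fails for every
`n ≥ 1` (so that row `bg` idles; vet ym-vet-20289, Summits-side `…/Negative/PartCompatDodge.lean`) carry NO v1.3 proviso set — the hypothesis `4 ∣ M` of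
that dodge contradicts the field `hM`. [cite: Balaban1988Convergent, p.245, p.257 (bookkeeping)] -/
theorem Stage13Params.Provisos₁₃SepMixed.not_four_dvd_M {θ : Stage13Params F N} (h : θ.Provisos₁₃SepMixed F N) : ¬ 4 ∣ θ.τ9.M := fun h4 =>
  (Nat.not_even_iff_odd.mpr h.odd_M) (even_iff_two_dvd.mpr (dvd_trans (by norm_num : (2 : ℕ) ∣ 4) h4))

/-- (v1.3 pin, director-ym №145 (F2)) **H1 AT EVERY 𝐃_j-CUBE**: `M₁ ∣ L^j·M·R_j` = `dCubeSide L M R_j j` for every `L`, `R_j`, `j` — the (2.13) layers tile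
the 𝐃_j-cubes ([15] (1) ∕ [6] (1.4) «Ω_j a union of M₁L^jη-blocks»). [cite: Balaban1985RegularSpaces, (1) p.277; Balaban1988Convergent, (2.1) p.254, (2.13) p.256 (bookkeeping)] -/
theorem Stage13Params.Provisos₁₃SepMixed.M₁_dvd_dCubeSide {θ : Stage13Params F N} (h : θ.Provisos₁₃SepMixed F N) (L R j : ℕ) :
    θ.ν.M₁ ∣ dCubeSide L θ.τ9.M R j :=
  (Dvd.dvd.mul_left h.hM₁ (L ^ j)).mul_right R

/-- **THE DEPRECATED PROVISOS IMPLY THE SEPARATED (7)-REGULAR-RANGE ONES** (`bg` by monotonicity in the support set; the nine other rows verbatim; the θ-level letters `hM` ∕ `hM₁` — `M` a power of `L`, `M₁ ∣ M`, [III] p. 245 — supplied): every inhabitant ∕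
consumer of `Provisos₁₃` re-points through this map. [cite: Balaban1988Convergent, (2.28) p.259; Balaban1985RegularSpaces, (1.3)–(1.6) p.77 (bookkeeping)] -/
theorem Stage13Params.Provisos₁₃.toSepMixed {θ : Stage13Params F N} (h : θ.Provisos₁₃ F N) (hM : ∃ a : ℕ, θ.τ9.M = F.L ^ a) (hM₁ : θ.ν.M₁ ∣ θ.τ9.M) : θ.Provisos₁₃SepMixed F N where
  intPiece := h.intPiece
  measω := h.measω
  measChi := h.measChi
  zetaUnity := h.zetaUnity
  zetaAbs := h.zetaAbs
  rstep := fun p k _ hk => h.rstep p k hk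
  rzLaws := h.rzLaws
  ztLaws := h.ztLaws
  ztLocal := h.ztLocal
  hM := hM
  hM₁ := hM₁
  bg := fun p n hn hw _ => bgProvisoΛ_suppOfRecord₁₃SepMixed_of_suppOfRecord₁₃ (h.bg p n hn hw)

/-- (v1.3 · SEPARATED (7)-REGULAR RANGE) The weight laws of the run FROM the provisos. [cite: Balaban1988Convergent, (2.21) p.258 (bookkeeping)] -/
theorem Stage13Params.Provisos₁₃SepMixed.wtLaws {θ : Stage13Params F N} (h : θ.Provisos₁₃SepMixed F N) (p : B12.RunParams) : (WtOfRecord₁₃ F N θ p).Laws :=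
  WtOfRecord₁₃_laws h.ztLaws p

/-- (v1.3 · SEPARATED (7)-REGULAR RANGE) **def-T's step provisos FROM the Stage-13 provisos** at every step `k < K` (as FILE 10's `Provisos₁₀.tstep`, along the ₁₃ histories).
[cite: Balaban1988Convergent, (3.2)–(3.9) pp.265–266, (3.16) p.268, (3.24)–(3.25) p.270] -/
theorem Stage13Params.Provisos₁₃SepMixed.tstep {θ : Stage13Params F N} (h : θ.Provisos₁₃SepMixed F N) (p : B12.RunParams) (k : ℕ) (hk : k < p.K) :
    TStepProvisos F N θ.ν θ.τ9 (EOfRecord₁₃ F N θ) (wOfRecord₉ F N θ.toStage9Params) θ.ppSel p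
      (gOfRecord₁₃ F N θ p) k where
  intPiece := h.intPiece p k hk
  measW := fun s' => measurable_wOfRecord F N θ.ν θ.τ9.M θ.A₁ θ.ζ p (gOfRecord₁₃ F N θ p) k (h.measω p k hk) s'
  absW_le := fun s' U V' => abs_wOfRecord_le_one F N θ.ν θ.τ9.M θ.A₁ h.zetaAbs p (gOfRecord₁₃ F N θ p) k s' U V'
  measChi := h.measChi p k hk
  unity := isStepUnity_wOfRecord F N θ.ν θ.τ9.M θ.A₁ h.zetaUnity p (gOfRecord₁₃ F N θ p) k

/-- (v1.3 · SEPARATED (7)-REGULAR RANGE) **NON-VACUITY OF THE SPACES OF RECORD AT THE RECORD, IN THE WINDOW**, Stage 13 (11c's `Sect2.one_mem_spaceI`; radii by `alphaPos₁₂_of_window`).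
[cite: Balaban1987RG1, (1.11)–(1.16) p.262; Balaban1988Convergent, (2.28) p.259] -/
theorem one_mem_spaceI_stage13SepMixed {θ : Stage13Params F N} (h : θ.Provisos₁₃SepMixed F N) (hθ : θ.Admissible F N) (p : B12.RunParams) (j : ℕ) (Y : Set (Site (F.P p.K) 0))
    (hw : 0 < gOfRecord₁₃ F N θ p j ∧ gOfRecord₁₃ F N θ p j ≤ θ.γ) :
    Sect2.ofBackgroundC (ιSU N) (1 : GaugeField (F.P p.K) 0 (SU N)) ∈
      Sect2.spaceI (settingOfRecord₁₃ F N θ p) (θ.Rz p.K) θ.τ9.M j Y ((lfOfRecord₁₂ F N θ.toStage12Params).alpha0 (gOfRecord₁₃ F N θ p j))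
        ((lfOfRecord₁₂ F N θ.toStage12Params).alpha1 (gOfRecord₁₃ F N θ p j)) :=
  Sect2.one_mem_spaceI (settingOfRecord₁₃ F N θ p) hθ.1.pos.1 (h.rzLaws p.K) θ.τ9.M j Y (alphaPos₁₂_of_window hθ.1 hw.1 hw.2).1
    (alphaPos₁₂_of_window hθ.1 hw.1 hw.2).2

/-- (v1.3 · SEPARATED (7)-REGULAR RANGE) … and in `Ũ^c_j(X, α̃₀, α̃₁)` of record along the sequence's large-field regions, GIVEN positive radii at every level. [cite: Balaban1988Convergent, (2.34)–(2.39) p.261] -/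
theorem one_mem_spaceMS_stage13SepMixed {θ : Stage13Params F N} (h : θ.Provisos₁₃SepMixed F N) (hθ : θ.Admissible F N) (p : B12.RunParams) (j : ℕ) (Y : Set (Site (F.P p.K) 0))
    (Ω : ℕ → Set (Site (F.P p.K) 0))
    (hα : ∀ n, 0 < (lfOfRecord₁₂ F N θ.toStage12Params).alpha0 (gOfRecord₁₃ F N θ p n) ∧ 0 < (lfOfRecord₁₂ F N θ.toStage12Params).alpha1 (gOfRecord₁₃ F N θ p n)) :
    Sect2.ofBackgroundC (ιSU N) (1 : GaugeField (F.P p.K) 0 (SU N)) ∈ Sect2.spaceMS (settingOfRecord₁₃ F N θ p) (θ.Rz p.K) θ.τ9.M j Y Ω :=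
  Sect2.one_mem_spaceMS (settingOfRecord₁₃ F N θ p) (settingOfRecord₁₃_pos F N θ hθ.1.pos p) (h.rzLaws p.K) θ.τ9.M j Y Ω (fun n => (hα n).1) (fun n => (hα n).2)

/-- (v1.3 · SEPARATED (7)-REGULAR RANGE) **THE (2.27)(iv) BOUND BITES AT THE BACKGROUND OF RECORD**, Stage 13 (v1.1: ON PRINT'S RANGE `X ⊂ Λ_j(s)` — one binder `hX`; v1.2: on print's SEQUENCES and partition-compatible runs — one binder `hpc`): under the provisos, IN THE
WINDOW, whenever `ρ_k` of the run has the repaired §2 form of record (`SLaw₁₃`), its witnessing 𝐄-terms obey `|𝐄^{(j)}(X, U_k(s)(𝐖), z)| ≤ E₀ exp(−κ d_j(X))`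
POINTWISE at every regular retained configuration, for every domain `X ⊂ Λ_j(s)` of the (2.26)–(2.27) sums. [cite: Balaban1988Convergent, (2.23) p.258, (2.26)–(2.28) p.259] -/
theorem norm_E_bg_le_stage13SepMixed {θ : Stage13Params F N} (h : θ.Provisos₁₃SepMixed F N) (p : B12.RunParams) (k : ℕ) (hk : k ≤ p.K)
    (hw : Step.InInterval θ.γ k (gOfRecord₁₃ F N θ p)) (hpc : PartCompat₁₃ F N θ p k) (hS : SLaw₁₃ F N θ p k) :
    ∃ t : SeqOfRecord F θ.ν θ.τ9.M (gOfRecord₁₃ F N θ p) p.K k → Sect2.TermValues (F.P p.K) (MatA N) (FluctV N) θ.τ9.M,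
      Sect2.UniversalE t ∧ ∀ s Wc, Wc ∈ suppOfRecord₁₃SepMixed F N θ p k s → ∀ j, 1 ≤ j → j ≤ k →
        ∀ (X : (Sect2.domSys (F.P p.K) θ.τ9.M j).Dom), Sect2.domSites (F.P p.K) θ.τ9.M j X ⊆ s.Λ j →
          ∀ (z : Site (F.P p.K) j) (g' : ℝ), 0 ≤ g' → g' ≤ (lfOfRecord₁₂ F N θ.toStage12Params).γ →
            ‖(t s).E j X z g' (Sect2.ofBackgroundC (ιSU N) (UbgOfRecord₁₃ F N θ p k s Wc))‖ ≤
              (lfOfRecord₁₂ F N θ.toStage12Params).E₀ * Real.exp (-(lfOfRecord₁₂ F N θ.toStage12Params).κ * (Sect2.domSys (F.P p.K) θ.τ9.M j).dj X) :=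
  ((sLaw₁₃_iff F N θ p k).mp hS).norm_E_bg_le_Λ (h.bg p k hk hw hpc)

variable (F N)

/-! ### §9b. The tower and the datum of record RE-KEYED on `Provisos₁₃SepMixed`; faces; [V] Thm 1 induction; the record predicate `IsRecordOfRecord₁₃CSepMixed` -/

open Classical in
/-- (v1.3 · SEPARATED (7)-REGULAR RANGE) **THE TOWER OF RECORD at `θ` under its Stage-13 provisos**, BY HAND at the Stage-13 core (`RGMachineCore.Tower`'s five fields): `ρ := densOfRecord₁₃`,
`Trho := tdensOfRecord₁₃`; the Wilson start by `rhoZero_coreOfRecord₁₃`; the push-forward obligation by def-T's `isRT_trhoOfRecord9` under the step provisos;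
(0.4) at the step by `integral_densOfRecord₁₃_succ` under the INTEGRABLE-FORM `rstep` (at the classical instance). [cite: Balaban1988Convergent, (0.2) p.244, (2.18) p.257, (3.25) p.270; Balaban1989LargeFieldI, (0.4) p.176] -/
def towerOfRecord₁₃SepMixed (θ : Stage13Params F N) (h : θ.Provisos₁₃SepMixed F N) : (coreOfRecord₁₃ F N θ).Tower (avOfRecord F N) where
  ρ := fun p k => densOfRecord₁₃ F N θ p k
  Trho := fun p k => tdensOfRecord₁₃ F N θ p k
  rho_zero := fun p => (rhoZero_coreOfRecord₁₃ F N θ p).symm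
  isRT_Trho := fun p k hk => isRT_trhoOfRecord9 F N θ.ν θ.τ9 (EOfRecord₁₃ F N θ) (wOfRecord₉ F N θ.toStage9Params) θ.ppSel p
    (gOfRecord₁₃ F N θ p) k hk (h.tstep p k hk)
  integral_succ := fun p k hk => integral_densOfRecord₁₃_succ F N θ p k (h.rstep p k hk)

/-- (v1.3 · SEPARATED (7)-REGULAR RANGE) **THE DATUM OF RECORD, STAGE 13**. [cite: Balaban1989LargeFieldII, Thm 1 + (0.1) pp.355–356; Balaban1988Convergent, (0.2) p.244] -/
def datumOfRecord₁₃SepMixed (θ : Stage13Params F N) (h : θ.Provisos₁₃SepMixed F N) : FiniteEpsData F (SU N) :=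
  datumOfTower F N (coreOfRecord₁₃ F N θ) (towerOfRecord₁₃SepMixed F N θ h)

/-- BRIDGE (`rfl`, proof irrelevance): the separated-range tower IS the core-keyed tower at `h.toCore`. [cite: Balaban1988Convergent, (0.2) p.244 (bookkeeping)] -/
theorem towerOfRecord₁₃SepMixed_eq_core (θ : Stage13Params F N) (h : θ.Provisos₁₃SepMixed F N) :
    towerOfRecord₁₃SepMixed F N θ h = towerOfRecord₁₃Core F N θ h.toCore := rfl

/-- BRIDGE (`rfl`): the separated-range datum IS the core-keyed datum at `h.toCore`. [cite: Balaban1989LargeFieldII, Thm 1 + (0.1) pp.355–356 (bookkeeping)] -/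
theorem datumOfRecord₁₃SepMixed_eq_core (θ : Stage13Params F N) (h : θ.Provisos₁₃SepMixed F N) :
    datumOfRecord₁₃SepMixed F N θ h = datumOfRecord₁₃Core F N θ h.toCore := rfl

/-- BRIDGE (`rfl`): along `Provisos₁₃.toSepMixed` the separated-range tower IS the v1.1 tower. [cite: Balaban1988Convergent, (0.2) p.244 (bookkeeping)] -/
theorem towerOfRecord₁₃SepMixed_toSepMixed (θ : Stage13Params F N) (h : θ.Provisos₁₃ F N) (hM : ∃ a : ℕ, θ.τ9.M = F.L ^ a) (hM₁ : θ.ν.M₁ ∣ θ.τ9.M) :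
    towerOfRecord₁₃SepMixed F N θ (h.toSepMixed hM hM₁) = towerOfRecord₁₃ F N θ h := rfl

/-- BRIDGE (`rfl`): along `Provisos₁₃.toSepMixed` the separated-range datum IS the v1.1 datum — every datum of record of v1.1 is one of v1.2.
[cite: Balaban1989LargeFieldII, Thm 1 + (0.1) pp.355–356 (bookkeeping)] -/
theorem datumOfRecord₁₃SepMixed_toSepMixed (θ : Stage13Params F N) (h : θ.Provisos₁₃ F N) (hM : ∃ a : ℕ, θ.τ9.M = F.L ^ a) (hM₁ : θ.ν.M₁ ∣ θ.τ9.M) :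
    datumOfRecord₁₃SepMixed F N θ (h.toSepMixed hM hM₁) = datumOfRecord₁₃ F N θ h := rfl

/-- (v1.3 · SEPARATED (7)-REGULAR RANGE) The tower's densities ARE `densOfRecord₁₃` (`rfl`). [cite: Balaban1988Convergent, (2.18) p.257 (bookkeeping)] -/
theorem towerOfRecord₁₃SepMixed_ρ (θ : Stage13Params F N) (h : θ.Provisos₁₃SepMixed F N) (p : B12.RunParams) (k : ℕ) :
    (towerOfRecord₁₃SepMixed F N θ h).ρ p k = densOfRecord₁₃ F N θ p k := rfl

/-- (v1.3 · SEPARATED (7)-REGULAR RANGE) The tower's `𝐓ρ_k` ARE `tdensOfRecord₁₃` (`rfl`). [cite: Balaban1988Convergent, (3.25) p.270 (bookkeeping)] -/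
theorem towerOfRecord₁₃SepMixed_Trho (θ : Stage13Params F N) (h : θ.Provisos₁₃SepMixed F N) (p : B12.RunParams) (k : ℕ) :
    (towerOfRecord₁₃SepMixed F N θ h).Trho p k = tdensOfRecord₁₃ F N θ p k := rfl

/-- (v1.3 · SEPARATED (7)-REGULAR RANGE) `ρ₀` of the tower is integrable on every run: `e^{−E(p)}` times the Wilson–Boltzmann weight (`Missing.integrable_boltzmann`). [cite: Balaban1988Convergent, Thm 1 p.262 (bookkeeping)] -/
theorem integrable_towerOfRecord₁₃SepMixed_ρ_zero (θ : Stage13Params F N) (h : θ.Provisos₁₃SepMixed F N) (p : B12.RunParams) :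
    Integrable ((towerOfRecord₁₃SepMixed F N θ h).ρ p 0) (fieldMeasure (F.P p.K) 0 (SU N)) := by
  rw [(towerOfRecord₁₃SepMixed F N θ h).rho_zero p]
  exact (Missing.integrable_boltzmann RegularGaugeGroup.measurable_reTr (F.P p.K) (sq_nonneg _)).const_mul _

open Classical in
/-- (v1.3 · SEPARATED (7)-REGULAR RANGE) `ρ_{k+1}` of the tower is integrable, `k < K`: the (0.3)-density of the R-stepped pre-𝐑 slot under the integrable-form `rstep` (def-R's
`integrable_densityOfSlice_rstepSlotOfRecord_of_provisosInt`). [cite: Balaban1989LargeFieldI, (0.3)–(0.4) p.176 (bookkeeping)] -/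
theorem integrable_towerOfRecord₁₃SepMixed_ρ_succ (θ : Stage13Params F N) (h : θ.Provisos₁₃SepMixed F N) (p : B12.RunParams) (k : ℕ) (hk : k < p.K) :
    Integrable ((towerOfRecord₁₃SepMixed F N θ h).ρ p (k + 1)) (fieldMeasure (F.P p.K) (k + 1) (SU N)) := by
  rw [towerOfRecord₁₃SepMixed_ρ, densOfRecord₁₃_succ]
  exact integrable_densityOfSlice_rstepSlotOfRecord_of_provisosInt F N θ.ν θ.τ9 _ θ.ppSel p _ (k + 1) (h.rstep p k hk)

/-- (v1.3 · SEPARATED (7)-REGULAR RANGE) **THE TOWER OF RECORD IS INTEGRABLE** (`RGMachineCore.Tower.IsIntegrable`): every `ρ_k`, `k ≤ K`, from the displayed provisos alone. [cite: Balaban1988Convergent, (0.2) p.244 (bookkeeping)] -/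
theorem isIntegrable_towerOfRecord₁₃SepMixed (θ : Stage13Params F N) (h : θ.Provisos₁₃SepMixed F N) : (towerOfRecord₁₃SepMixed F N θ h).IsIntegrable
  | p, 0, _ => integrable_towerOfRecord₁₃SepMixed_ρ_zero F N θ h p
  | p, k + 1, hk => integrable_towerOfRecord₁₃SepMixed_ρ_succ F N θ h p k (Nat.lt_of_succ_le hk)

/-- (v1.3 · SEPARATED (7)-REGULAR RANGE) … and every `𝐓ρ_k`, `k < K`, is integrable (def-T's `integrable_piece_trhoOfRecord9` summed). [cite: Balaban1988Convergent, (3.25) p.270 (bookkeeping)] -/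
theorem integrable_towerOfRecord₁₃SepMixed_Trho (θ : Stage13Params F N) (h : θ.Provisos₁₃SepMixed F N) (p : B12.RunParams) (k : ℕ) (hk : k < p.K) :
    Integrable ((towerOfRecord₁₃SepMixed F N θ h).Trho p k) (fieldMeasure (F.P p.K) (k + 1) (SU N)) :=
  integrable_finsetSum Finset.univ (fun s' _ => integrable_piece_trhoOfRecord9 F N θ.ν θ.τ9 (EOfRecord₁₃ F N θ) (wOfRecord₉ F N θ.toStage9Params)
    θ.ppSel p (gOfRecord₁₃ F N θ p) k hk (h.tstep p k hk) s')

/-- (v1.3 · SEPARATED (7)-REGULAR RANGE) FACE `dens` (`rfl`). [cite: Balaban1988Convergent, (2.18) p.257 (bookkeeping)] -/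
theorem dens_datumOfRecord₁₃SepMixed (θ : Stage13Params F N) (h : θ.Provisos₁₃SepMixed F N) (K : ℕ) (g₀ : ℝ) (k : ℕ) :
    (datumOfRecord₁₃SepMixed F N θ h).dens K g₀ k = densOfRecord₁₃ F N θ ⟨K, F.m, g₀⟩ k := rfl

/-- (v1.3 · SEPARATED (7)-REGULAR RANGE) FACE `Trho` (`rfl`). [cite: Balaban1988Convergent, (3.25) p.270 (bookkeeping)] -/
theorem trho_datumOfRecord₁₃SepMixed (θ : Stage13Params F N) (h : θ.Provisos₁₃SepMixed F N) (K : ℕ) (g₀ : ℝ) (k : ℕ) :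
    (datumOfRecord₁₃SepMixed F N θ h).real.Trho K g₀ k = tdensOfRecord₁₃ F N θ ⟨K, F.m, g₀⟩ k := rfl

/-- (v1.3 · SEPARATED (7)-REGULAR RANGE) FACE `𝐑` (`rfl`). [cite: Balaban1989LargeFieldI, (0.2)–(0.3) p.176 (bookkeeping)] -/
theorem R_datumOfRecord₁₃SepMixed_eq_VOfRecord₁₃ (θ : Stage13Params F N) (h : θ.Provisos₁₃SepMixed F N) (K : ℕ) (g₀ : ℝ) (k : ℕ) :
    (datumOfRecord₁₃SepMixed F N θ h).real.R K g₀ k = (VOfRecord₁₃ F N θ ⟨K, F.m, g₀⟩).R k := rfl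

/-- (v1.3 · SEPARATED (7)-REGULAR RANGE) … and maps `𝐓ρ_k ↦ ρ_{k+1}`. [cite: Balaban1988Convergent, (0.2) p.244; Balaban1989LargeFieldI, (0.3) p.176] -/
theorem R_tdens_datumOfRecord₁₃SepMixed (θ : Stage13Params F N) (h : θ.Provisos₁₃SepMixed F N) (K : ℕ) (g₀ : ℝ) (k : ℕ) :
    (datumOfRecord₁₃SepMixed F N θ h).real.R K g₀ k (tdensOfRecord₁₃ F N θ ⟨K, F.m, g₀⟩ k) =
      densOfRecord₁₃ F N θ ⟨K, F.m, g₀⟩ (k + 1) :=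
  (towerOfRecord₁₃SepMixed F N θ h).inducedR_Trho ⟨K, F.m, g₀⟩ k

/-- (v1.3 · SEPARATED (7)-REGULAR RANGE) FACE construction (`rfl`). [cite: Balaban1989LargeFieldII, Thm 1 + (0.1) pp.355–356 (bookkeeping)] -/
theorem datumOfRecord₁₃SepMixed_C (θ : Stage13Params F N) (h : θ.Provisos₁₃SepMixed F N) :
    (datumOfRecord₁₃SepMixed F N θ h).C = (coreOfRecord₁₃ F N θ).construction (densOfRecord₁₃ F N θ) := rfl

/-- (v1.3 · SEPARATED (7)-REGULAR RANGE) FACE β: the datum's β-functions ARE `betaOfRecord₁₃ θ` (`rfl`). [cite: Balaban1987RG1, (1.20)–(1.22) p.264 (bookkeeping)] -/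
theorem βfun_datumOfRecord₁₃SepMixed (θ : Stage13Params F N) (h : θ.Provisos₁₃SepMixed F N) :
    (datumOfRecord₁₃SepMixed F N θ h).βfun = betaOfRecord₁₃ F N θ := rfl

/-- (v1.3 · SEPARATED (7)-REGULAR RANGE) … i.e. the χ-generic β at `T := TcanOfRecord`, `χ := chiFixed29 θ.ν θ.ε₂₉` (`rfl`). [cite: Balaban1987RG1, (1.20)–(1.22) p.264, (2.9) p.266 (bookkeeping)] -/
theorem βfun_datumOfRecord₁₃SepMixed_eq_betaOfRecord₈Tχ (θ : Stage13Params F N) (h : θ.Provisos₁₃SepMixed F N) :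
    (datumOfRecord₁₃SepMixed F N θ h).βfun = betaOfRecord₈Tχ F N (TcanOfRecord F N) (chiFixed29 F N θ.ν θ.ε₂₉) θ.toStage8Params := rfl

/-- (v1.3 · SEPARATED (7)-REGULAR RANGE) FACE flow (`rfl`). [cite: Balaban1987RG1, (0.17)–(0.20) pp.255–256 (bookkeeping)] -/
theorem flow_g_datumOfRecord₁₃SepMixed (θ : Stage13Params F N) (h : θ.Provisos₁₃SepMixed F N) (p : B12.RunParams) :
    ((datumOfRecord₁₃SepMixed F N θ h).C p).flow.g = gOfRecord₁₃ F N θ p := rfl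

/-- (v1.3 · SEPARATED (7)-REGULAR RANGE) FACE av (`rfl`). [cite: Balaban1987RG1, (0.4) p.253 (bookkeeping)] -/
theorem av_datumOfRecord₁₃SepMixed (θ : Stage13Params F N) (h : θ.Provisos₁₃SepMixed F N) : (datumOfRecord₁₃SepMixed F N θ h).av = avOfRecord F N := rfl

/-- (v1.3 · SEPARATED (7)-REGULAR RANGE) STAGE-0 DATUM CLAUSE at the Stage-13 datum (`rfl`). [cite: Balaban1987RG1, (0.3)–(0.4) p.253] -/
theorem isDatumOfRecord₀_datumOfRecord₁₃SepMixed (θ : Stage13Params F N) (h : θ.Provisos₁₃SepMixed F N) : IsDatumOfRecord₀ F N (datumOfRecord₁₃SepMixed F N θ h) := rfl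

/-- (v1.3 · SEPARATED (7)-REGULAR RANGE) BINDER B1 = NODE N23 at the Stage-13 datum. [cite: Balaban1987RG1, (0.4) p.253] -/
theorem isPrintedAveraged_datumOfRecord₁₃SepMixed (θ : Stage13Params F N) (h : θ.Provisos₁₃SepMixed F N) : (datumOfRecord₁₃SepMixed F N θ h).IsPrintedAveraged :=
  isPrintedAveraged_datumOfTower F N _ _

/-- (v1.3 · SEPARATED (7)-REGULAR RANGE) FACE χ ∕ actions ∕ `IndAss` ∕ `Repr`: the Stage-13 core's fields (`rfl`). [cite: Balaban1987RG1, (0.17)–(0.24) pp.255–257 (bookkeeping)] -/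
theorem actionSide_stage13SepMixed (θ : Stage13Params F N) (h : θ.Provisos₁₃SepMixed F N) (p : B12.RunParams) (k : ℕ) :
    ((datumOfRecord₁₃SepMixed F N θ h).C p).χ k = (coreOfRecord₁₃ F N θ).χ p k ∧
      ((datumOfRecord₁₃SepMixed F N θ h).C p).effAction k = (coreOfRecord₁₃ F N θ).effAction p k ∧
        ((datumOfRecord₁₃SepMixed F N θ h).C p).Ek k = (coreOfRecord₁₃ F N θ).Ek p k ∧
          (((datumOfRecord₁₃SepMixed F N θ h).C p).IndAss k ↔ (coreOfRecord₁₃ F N θ).IndAss p k) ∧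
            (((datumOfRecord₁₃SepMixed F N θ h).C p).Repr k ↔ (coreOfRecord₁₃ F N θ).Repr p k) :=
  ⟨rfl, rfl, rfl, Iff.rfl, Iff.rfl⟩

/-- (v1.3 · SEPARATED (7)-REGULAR RANGE) **FACE `Sect2Form`**: the construction's §2 [III] clause at step `k` IS the repaired §2 form of the post-𝐑 slot family of `ρ_k`, Stage 13.
[cite: Balaban1988Convergent, (2.17)–(2.18) p.257, (2.23)–(2.42) pp.258–261, Thm 1 p.262] -/
theorem sect2Form_stage13SepMixed_iff (θ : Stage13Params F N) (h : θ.Provisos₁₃SepMixed F N) (p : B12.RunParams) (k : ℕ) :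
    ((datumOfRecord₁₃SepMixed F N θ h).C p).Sect2Form k ↔
      HasSect2FormAEZ F N (FluctV N) p.K (settingOfRecord₁₃ F N θ p) (θ.Rz p.K) (WtOfRecord₁₃ F N θ p) k
        (UbgOfRecord₁₃ F N θ p k)
        (slotsOfRecord F N θ.ν θ.τ9 (EOfRecord₁₃ F N θ) (wOfRecord₉ F N θ.toStage9Params) θ.ppSel p
          (gOfRecord₁₃ F N θ p) k) :=
  sLaw₁₃_iff F N θ p k

/-- (v1.3 · SEPARATED (7)-REGULAR RANGE) (2.18) holds for the datum's densities with `rep_k` of record, by construction. [cite: Balaban1988Convergent, (2.18) p.257] -/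
theorem holds_dens_datumOfRecord₁₃SepMixed (θ : Stage13Params F N) (h : θ.Provisos₁₃SepMixed F N) (K : ℕ) (g₀ : ℝ) (k : ℕ) :
    (reprOfRecord₁₃ F N θ ⟨K, F.m, g₀⟩ k).Holds ((datumOfRecord₁₃SepMixed F N θ h).dens K g₀ k) :=
  holds_densOfRecord₁₃ F N θ _ k

/-- (v1.3 · SEPARATED (7)-REGULAR RANGE) FACE Wilson start. [cite: Balaban1988Convergent, Thm 1 p.262] -/
theorem dens_zero_datumOfRecord₁₃SepMixed (θ : Stage13Params F N) (h : θ.Provisos₁₃SepMixed F N) (K : ℕ) (g₀ : ℝ) :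
    (datumOfRecord₁₃SepMixed F N θ h).dens K g₀ 0 = rhoZeroOfRecord F N K g₀ (EOfRecord₁₃ F N θ ⟨K, F.m, g₀⟩) :=
  densOfRecord₁₃_zero F N θ ⟨K, F.m, g₀⟩

/-- (v1.3 · SEPARATED (7)-REGULAR RANGE) FACE push-forward: `𝐓ρ_k` IS an averaging-of-record image of `ρ_k` (`k < K`). [cite: Balaban1988Convergent, (3.1) p.264, (3.24)–(3.25) p.270] -/
theorem isRT_trho_datumOfRecord₁₃SepMixed (θ : Stage13Params F N) (h : θ.Provisos₁₃SepMixed F N) (K : ℕ) (g₀ : ℝ) (k : ℕ) (hk : k < K) :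
    IsRT (avOfRecord F N K k).avg ((datumOfRecord₁₃SepMixed F N θ h).dens K g₀ k) ((datumOfRecord₁₃SepMixed F N θ h).real.Trho K g₀ k) :=
  (towerOfRecord₁₃SepMixed F N θ h).isRT_Trho ⟨K, F.m, g₀⟩ k hk

/-- (v1.3 · SEPARATED (7)-REGULAR RANGE) FACE (0.4) at the step: `∫ρ_{k+1} = ∫𝐓ρ_k` (`k < K`). [cite: Balaban1989LargeFieldI, (0.4) p.176] -/
theorem integral_dens_succ_datumOfRecord₁₃SepMixed (θ : Stage13Params F N) (h : θ.Provisos₁₃SepMixed F N) (K : ℕ) (g₀ : ℝ) (k : ℕ) (hk : k < K) :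
    ∫ V, (datumOfRecord₁₃SepMixed F N θ h).dens K g₀ (k + 1) V ∂fieldMeasure (F.P K) (k + 1) (SU N)
      = ∫ V, (datumOfRecord₁₃SepMixed F N θ h).real.Trho K g₀ k V ∂fieldMeasure (F.P K) (k + 1) (SU N) :=
  (towerOfRecord₁₃SepMixed F N θ h).integral_succ ⟨K, F.m, g₀⟩ k hk

/-- (v1.3 · SEPARATED (7)-REGULAR RANGE) `∫ρ_k = ∫ρ₀` along every run, `k ≤ K`. [cite: Balaban1985UV3, (6) p.257] -/
theorem integral_dens_eq_zero_datumOfRecord₁₃SepMixed (θ : Stage13Params F N) (h : θ.Provisos₁₃SepMixed F N) (K : ℕ) (g₀ : ℝ) (k : ℕ) (hk : k ≤ K) :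
    ∫ V, (datumOfRecord₁₃SepMixed F N θ h).dens K g₀ k V ∂fieldMeasure (F.P K) k (SU N)
      = ∫ U, (datumOfRecord₁₃SepMixed F N θ h).dens K g₀ 0 U ∂fieldMeasure (F.P K) 0 (SU N) :=
  (towerOfRecord₁₃SepMixed F N θ h).integral_eq_integral_zero ⟨K, F.m, g₀⟩ k hk

/-- (v1.3 · SEPARATED (7)-REGULAR RANGE) FACE integrability: every density of the datum, `k ≤ K`, is integrable. [cite: Balaban1988Convergent, (0.2) p.244 (bookkeeping)] -/
theorem integrable_dens_datumOfRecord₁₃SepMixed (θ : Stage13Params F N) (h : θ.Provisos₁₃SepMixed F N) (K : ℕ) (g₀ : ℝ) (k : ℕ) (hk : k ≤ K) :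
    Integrable ((datumOfRecord₁₃SepMixed F N θ h).dens K g₀ k) (fieldMeasure (F.P K) k (SU N)) :=
  isIntegrable_towerOfRecord₁₃SepMixed F N θ h ⟨K, F.m, g₀⟩ k hk

/-- (v1.3 · SEPARATED (7)-REGULAR RANGE) … and so is every realised `𝐓ρ_k`, `k < K`. [cite: Balaban1988Convergent, (3.25) p.270 (bookkeeping)] -/
theorem integrable_trho_datumOfRecord₁₃SepMixed (θ : Stage13Params F N) (h : θ.Provisos₁₃SepMixed F N) (K : ℕ) (g₀ : ℝ) (k : ℕ) (hk : k < K) :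
    Integrable ((datumOfRecord₁₃SepMixed F N θ h).real.Trho K g₀ k) (fieldMeasure (F.P K) (k + 1) (SU N)) :=
  integrable_towerOfRecord₁₃SepMixed_Trho F N θ h ⟨K, F.m, g₀⟩ k hk

/-- (v1.3 · SEPARATED (7)-REGULAR RANGE) The T⁴ apex at the Stage-13 datum, B1 eliminated. [cite: JaffeWittenClay2006, §6.5 p.11] -/
theorem continuumYM4Torus_datumOfRecord₁₃SepMixed (θ : Stage13Params F N) (h : θ.Provisos₁₃SepMixed F N)
    (hB : B16.EndStatementBPrinted (datumOfRecord₁₃SepMixed F N θ h).C)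
    (hE : EndpointExistence (datumOfRecord₁₃SepMixed F N θ h).C.toB12)
    (hNE : T4ApexHybrid.HybridNE7Under (datumOfRecord₁₃SepMixed F N θ h) (EndpointExistence (datumOfRecord₁₃SepMixed F N θ h).C.toB12)) :
    T4ContinuumYM4Torus.ContinuumYM4Torus (datumOfRecord₁₃SepMixed F N θ h) :=
  continuumYM4Torus_datumOfTower F N _ _ hB hE hNE

/-- (v1.3 · SEPARATED (7)-REGULAR RANGE) **THE BASE HOLDS** on every run of the Stage-13 datum (`sLaw₁₃_zero`). [cite: Balaban1988Convergent, Thm 1 p.262; Balaban1989LargeFieldII, Thm 1 p.355 (bookkeeping)] -/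
theorem sect2Form_zero_datumOfRecord₁₃SepMixed (θ : Stage13Params F N) (h : θ.Provisos₁₃SepMixed F N) (P : B12.RunParams) :
    ((datumOfRecord₁₃SepMixed F N θ h).C P).Sect2Form 0 :=
  (sect2Form_stage13SepMixed_iff F N θ h P 0).mpr ((sLaw₁₃_iff F N θ P 0).mp (sLaw₁₃_zero F N θ P))

/-- (v1.3 · SEPARATED (7)-REGULAR RANGE) **`B16.InductionBase` AT THE STAGE-13 DATUM, for every window letter `γ`, NO hypothesis.** [cite: Balaban1988Convergent, Thm 1 p.262; Balaban1989LargeFieldII, Thm 1 p.355 + p.391] -/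
theorem inductionBase_datumOfRecord₁₃SepMixed (θ : Stage13Params F N) (h : θ.Provisos₁₃SepMixed F N) (γ : ℝ) : B16.InductionBase (datumOfRecord₁₃SepMixed F N θ h).C γ :=
  fun P _ => sect2Form_zero_datumOfRecord₁₃SepMixed F N θ h P

/-- (v1.3 · SEPARATED (7)-REGULAR RANGE) **THE STEP OF THEOREM 1 AT THE OBJECTS OF RECORD, Stage 13**: along every run in the `γ`-window, from the 𝐓-STEP LAW «`SLaw₁₃ k → TLaw₁₃ k`» and the 𝐑-LEAF
`ROpLeaf (VOfRecord₁₃ θ P)`.  Both hypotheses DISPLAYED. [cite: Balaban1989LargeFieldII, Thm 1 p.355 and pp.390–391; Balaban1988Convergent, Thm p.245, Thm 2 p.263] -/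
theorem inductionStep_datumOfRecord₁₃SepMixed_of_tLaw_rOpLeaf (θ : Stage13Params F N) (h : θ.Provisos₁₃SepMixed F N) (γ : ℝ)
    (hT : ∀ P : B12.RunParams, ((datumOfRecord₁₃SepMixed F N θ h).C P).flow.InInterval γ P.K →
      ∀ k, k < P.K → SLaw₁₃ F N θ P k → TLaw₁₃ F N θ P k)
    (hR : ∀ P : B12.RunParams, ((datumOfRecord₁₃SepMixed F N θ h).C P).flow.InInterval γ P.K → ROpLeaf (VOfRecord₁₃ F N θ P)) :
    B16.InductionStep (datumOfRecord₁₃SepMixed F N θ h).C γ := by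
  intro P hP k hk hS
  have hS' : SLaw₁₃ F N θ P k := (sLaw₁₃_iff F N θ P k).mpr ((sect2Form_stage13SepMixed_iff F N θ h P k).mp hS)
  exact (sect2Form_stage13SepMixed_iff F N θ h P (k + 1)).mpr
    ((sLaw₁₃_iff F N θ P (k + 1)).mp ((rOpLeaf_VOfRecord₁₃_iff F N θ P).mp (hR P hP) k hk (hT P hP k hk hS')))

/-- (v1.3 · SEPARATED (7)-REGULAR RANGE) **[V] THEOREM 1 AT THE STAGE-13 DATUM FROM ITS PRINTED PIECES WITHOUT A BASE HYPOTHESIS.** [cite: Balaban1989LargeFieldII, Thm 1 p.355 + p.391; Balaban1988Convergent, Thm 1 p.262, Thm p.245, Thm 2 p.263] -/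
theorem thm1Printed_datumOfRecord₁₃SepMixed_of_tLaw_rOpLeaf (θ : Stage13Params F N) (h : θ.Provisos₁₃SepMixed F N) {γ : ℝ} (hγ : 0 < γ)
    (hT : ∀ P : B12.RunParams, ((datumOfRecord₁₃SepMixed F N θ h).C P).flow.InInterval γ P.K →
      ∀ k, k < P.K → SLaw₁₃ F N θ P k → TLaw₁₃ F N θ P k)
    (hR : ∀ P : B12.RunParams, ((datumOfRecord₁₃SepMixed F N θ h).C P).flow.InInterval γ P.K → ROpLeaf (VOfRecord₁₃ F N θ P)) :
    B16.Thm1Printed (datumOfRecord₁₃SepMixed F N θ h).C :=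
  B16.thm1_of_steps _ γ hγ (inductionBase_datumOfRecord₁₃SepMixed F N θ h γ) (inductionStep_datumOfRecord₁₃SepMixed_of_tLaw_rOpLeaf F N θ h γ hT hR)

/-- (v1.3 · SEPARATED (7)-REGULAR RANGE) **«(D, w) is the record, Stage 13»**: admissible Stage-13 parameters SATISFYING THE STAGE-13 PROVISOS whose Stage-13 datum of record IS `D`, and a world bound
to its construction with a window `0 < w.γ ≤ θ.γ`, Bałaban's block size and the C-binding of record over the Stage-13 view. [cite: Balaban1989LargeFieldII, Thm 1 + (0.1) pp.355–356; Balaban1988Convergent, (0.2) p.244, (2.17)–(2.18) p.257, Thms 1–2 pp.262–263; Balaban1989LargeFieldI, (0.2)–(0.4) p.176; Balaban1987RG1, p.259 (objects of record; bookkeeping)] -/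
def IsRecordOfRecord₁₃CSepMixed (D : FiniteEpsData F (SU N)) (w : WorldP) : Prop :=
  ∃ (θ : Stage13Params F N) (h : θ.Provisos₁₃SepMixed F N), θ.Admissible F N ∧ D = datumOfRecord₁₃SepMixed F N θ h ∧ w.C = D.C ∧ (0 < w.γ ∧ w.γ ≤ θ.γ) ∧
    w.L = (θ.L : ℝ) ∧ ∀ P : B12.RunParams, w.up P = upOfRecord₅C F N (θ.toStage5₁₃ F N) P

/-- (v1.3 · SEPARATED (7)-REGULAR RANGE) **Pointed form**. [cite: Balaban1989LargeFieldII, Thm 1 + (0.1) pp.355–356 (bookkeeping)] -/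
theorem isRecordOfRecord₁₃CSepMixed_of_eq (θ : Stage13Params F N) (h : θ.Provisos₁₃SepMixed F N) (hθ : θ.Admissible F N) (w : WorldP)
    (hC : w.C = (datumOfRecord₁₃SepMixed F N θ h).C) (hγ : 0 < w.γ ∧ w.γ ≤ θ.γ) (hL : w.L = (θ.L : ℝ))
    (hup : ∀ P, w.up P = upOfRecord₅C F N (θ.toStage5₁₃ F N) P) :
    IsRecordOfRecord₁₃CSepMixed F N (datumOfRecord₁₃SepMixed F N θ h) w :=
  ⟨θ, h, hθ, rfl, hC, hγ, hL, hup⟩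

/-- (v1.3 · SEPARATED (7)-REGULAR RANGE) **Every admissible Stage-12 parameter satisfying the Stage-13 provisos IS a Stage-13 record at some world**, with any window `0 < γw ≤ θ.γ`.
[cite: Balaban1989LargeFieldII, Thm 1 + (0.1) pp.355–356 (bookkeeping)] -/
theorem exists_world_isRecordOfRecord₁₃CSepMixed (θ : Stage13Params F N) (h : θ.Provisos₁₃SepMixed F N) (hθ : θ.Admissible F N) {γw : ℝ} (hγw : 0 < γw ∧ γw ≤ θ.γ) :
    ∃ w : WorldP, IsRecordOfRecord₁₃CSepMixed F N (datumOfRecord₁₃SepMixed F N θ h) w ∧ w.γ = γw := by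
  obtain ⟨w₀⟩ := nonempty_worldP
  exact ⟨{ w₀ with
      C := (datumOfRecord₁₃SepMixed F N θ h).C, γ := γw, L := (θ.L : ℝ), one_lt_L := by exact_mod_cast θ.hL.2,
      up := fun P => upOfRecord₅C F N (θ.toStage5₁₃ F N) P },
    ⟨θ, h, hθ, rfl, rfl, hγw, rfl, fun _ => rfl⟩, rfl⟩

variable {F N} in
/-- **EVERY v1.1 RECORD IS A v1.3 RECORD, GIVEN THE PINS `M = L^a`, `M₁ ∣ M` ON v1.1 CARRIERS** (along `Provisos₁₃.toSepMixed`, same datum by `rfl`). [cite: Balaban1989LargeFieldII, Thm 1 + (0.1) pp.355–356 (bookkeeping)] -/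
theorem IsRecordOfRecord₁₃C.toSepMixed {D : FiniteEpsData F (SU N)} {w : WorldP} (h : IsRecordOfRecord₁₃C F N D w)
    (hM : ∀ θ : Stage13Params F N, θ.Provisos₁₃ F N → (∃ a : ℕ, θ.τ9.M = F.L ^ a) ∧ θ.ν.M₁ ∣ θ.τ9.M) :
    IsRecordOfRecord₁₃CSepMixed F N D w := by
  obtain ⟨θ, hP, hθ, hD, hC, hγ, hL, hup⟩ := h
  exact ⟨θ, hP.toSepMixed (hM θ hP).1 (hM θ hP).2, hθ, hD, hC, hγ, hL, hup⟩

section ConsequencesSepMixed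

variable {F N}
variable {D : FiniteEpsData F (SU N)} {w : WorldP}

/-- (v1.3 · SEPARATED (7)-REGULAR RANGE) A Stage-13 record CERTIFIES its parameters' provisos and admissibility. [cite: Balaban1989LargeFieldI, (0.3)–(0.4) p.176 (bookkeeping)] -/
theorem exists_provisos_of_isRecordOfRecord₁₃CSepMixed (h : IsRecordOfRecord₁₃CSepMixed F N D w) :
    ∃ (θ : Stage13Params F N) (hP : θ.Provisos₁₃SepMixed F N), θ.Admissible F N ∧ D = datumOfRecord₁₃SepMixed F N θ hP := by
  obtain ⟨θ, hP, hθ, hD, -⟩ := h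
  exact ⟨θ, hP, hθ, hD⟩

/-- (v1.3 · SEPARATED (7)-REGULAR RANGE) Binding clause 1: the world's construction IS the datum's. [cite: Balaban1989LargeFieldII, Thm 1 p.355 (bookkeeping)] -/
theorem construction_eq_of_isRecordOfRecord₁₃CSepMixed (h : IsRecordOfRecord₁₃CSepMixed F N D w) : w.C = D.C := by
  obtain ⟨θ, hP, -, -, hC, -⟩ := h
  exact hC

/-- (v1.3 · SEPARATED (7)-REGULAR RANGE) Binding clause 2: the interval constant is positive. [cite: Balaban1989LargeFieldII, Thm 1 p.355 (bookkeeping)] -/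
theorem gamma_pos_of_isRecordOfRecord₁₃CSepMixed (h : IsRecordOfRecord₁₃CSepMixed F N D w) : 0 < w.γ := by
  obtain ⟨θ, hP, -, -, -, hγ, -⟩ := h
  exact hγ.1

/-- (v1.3 · SEPARATED (7)-REGULAR RANGE) A Stage-13 record's datum is a datum of record, Stage 0. [cite: Balaban1987RG1, (0.3)–(0.4) p.253 (bookkeeping)] -/
theorem isDatumOfRecord₀_of_isRecordOfRecord₁₃CSepMixed (h : IsRecordOfRecord₁₃CSepMixed F N D w) : IsDatumOfRecord₀ F N D := by
  obtain ⟨θ, hP, -, rfl, -⟩ := h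
  exact isDatumOfRecord₀_datumOfRecord₁₃SepMixed F N θ hP

/-- (v1.3 · SEPARATED (7)-REGULAR RANGE) N23 · binder B1 at every Stage-13 record. [cite: Balaban1987RG1, (0.4) p.253] -/
theorem isPrintedAveraged_of_isRecordOfRecord₁₃CSepMixed (h : IsRecordOfRecord₁₃CSepMixed F N D w) : D.IsPrintedAveraged :=
  isPrintedAveraged_of_isDatumOfRecord₀ F N D (isDatumOfRecord₀_of_isRecordOfRecord₁₃CSepMixed h)

/-- (v1.3 · SEPARATED (7)-REGULAR RANGE) **A Stage-13 record's 𝐑-leaf IS «repaired 𝐓-image form ⇒ repaired §2 form one level up» along its tower of record**, at every run.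
[cite: Balaban1988Convergent, p.244, Thm 2 p.263; Balaban1989LargeFieldII, Thm 1 p.355 (bookkeeping)] -/
theorem exists_rOperation_iff_of_isRecordOfRecord₁₃CSepMixed (h : IsRecordOfRecord₁₃CSepMixed F N D w) :
    ∃ (θ : Stage13Params F N) (hP : θ.Provisos₁₃SepMixed F N), θ.Admissible F N ∧ D = datumOfRecord₁₃SepMixed F N θ hP ∧
      ∀ P : B12.RunParams, (leavesP w P).rOperation ↔ ∀ k, k < P.K → TLaw₁₃ F N θ P k → SLaw₁₃ F N θ P (k + 1) := by
  obtain ⟨θ, hP, hθ, hD, -, -, -, hup⟩ := h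
  refine ⟨θ, hP, hθ, hD, fun P => ?_⟩
  show (w.up P).rOperation ↔ _
  rw [hup P]
  exact rOperation_upOfRecord₅C_stage13_iff F N θ P

/-- (v1.3 · SEPARATED (7)-REGULAR RANGE) **AT A STAGE-13 RECORD WHOSE 𝐑-LEAVES HOLD, EVERY `ρ_{k+1}` WHOSE `𝐓ρ_k` HAS THE 𝐓-IMAGE FORM HAS THE REPAIRED §2 FORM OF RECORD.**
[cite: Balaban1988Convergent, Thm 2 p.263, (2.18) p.257, (2.23) p.258 (bookkeeping)] -/
theorem hasSect2FormAEZ_succ_of_isRecordOfRecord₁₃CSepMixed (h : IsRecordOfRecord₁₃CSepMixed F N D w) (hR : ∀ P : B12.RunParams, (leavesP w P).rOperation) :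
    ∃ (θ : Stage13Params F N) (hP : θ.Provisos₁₃SepMixed F N), θ.Admissible F N ∧ D = datumOfRecord₁₃SepMixed F N θ hP ∧
      ∀ (P : B12.RunParams) (k : ℕ), k < P.K → TLaw₁₃ F N θ P k →
        HasSect2FormAEZ F N (FluctV N) P.K (settingOfRecord₁₃ F N θ P) (θ.Rz P.K) (WtOfRecord₁₃ F N θ P) (k + 1)
          (UbgOfRecord₁₃ F N θ P (k + 1))
          (slotsOfRecord F N θ.ν θ.τ9 (EOfRecord₁₃ F N θ) (wOfRecord₉ F N θ.toStage9Params) θ.ppSel P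
            (gOfRecord₁₃ F N θ P) (k + 1)) := by
  obtain ⟨θ, hP, hθ, hD, hrop⟩ := exists_rOperation_iff_of_isRecordOfRecord₁₃CSepMixed h
  exact ⟨θ, hP, hθ, hD, fun P k hk hT => (sLaw₁₃_iff F N θ P (k + 1)).mp (((hrop P).mp (hR P)) k hk hT)⟩

/-- (v1.3 · SEPARATED (7)-REGULAR RANGE) **AT A STAGE-13 RECORD WHOSE 𝐑-LEAVES HOLD, [V] THEOREM 1 FOLLOWS FROM THE 𝐓-STEP LAW ALONE** (any window letter `γ > 0`).
[cite: Balaban1989LargeFieldII, Thm 1 p.355 + p.391; Balaban1988Convergent, Thm 1 p.262, Thm p.245, Thm 2 p.263 (bookkeeping)] -/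
theorem thm1Printed_of_isRecordOfRecord₁₃CSepMixed_of_tLaw (h : IsRecordOfRecord₁₃CSepMixed F N D w) (hR : ∀ P : B12.RunParams, (leavesP w P).rOperation) :
    ∃ (θ : Stage13Params F N) (hP : θ.Provisos₁₃SepMixed F N), θ.Admissible F N ∧ D = datumOfRecord₁₃SepMixed F N θ hP ∧
      ∀ γ : ℝ, 0 < γ → (∀ P : B12.RunParams, (D.C P).flow.InInterval γ P.K → ∀ k, k < P.K → SLaw₁₃ F N θ P k → TLaw₁₃ F N θ P k) →
        B16.Thm1Printed D.C := by
  obtain ⟨θ, hP, hθ, hD, hrop⟩ := exists_rOperation_iff_of_isRecordOfRecord₁₃CSepMixed h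
  refine ⟨θ, hP, hθ, hD, fun γ hγ hT => ?_⟩
  subst hD
  exact thm1Printed_datumOfRecord₁₃SepMixed_of_tLaw_rOpLeaf F N θ hP hγ hT
    (fun P _ => (rOpLeaf_VOfRecord₁₃_iff F N θ P).mpr ((hrop P).mp (hR P)))

end ConsequencesSepMixed

/-! ### §9c. The shadow RE-KEYED; refinement to the Stage-5 record predicate; transfer of world-reading theorems; β-layer faces -/

/-- (v1.3 · SEPARATED (7)-REGULAR RANGE) **THE SHADOW RESIDUAL of `θ` under its Stage-13 provisos** (as FILE 12b: `R :=` the induced operation at the Radon–Nikodym image of the tower of record, the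
format slot FROZEN at the density of record).  A PROOF DEVICE. [cite: Balaban1989LargeFieldI, (0.2)–(0.4) p.176; Balaban1987RG1, (0.13) p.254 (bookkeeping)] -/
def shadowResidual₁₃SepMixed (θ : Stage13Params F N) (h : θ.Provisos₁₃SepMixed F N) : Residual₅ F N :=
  { residualOfStage13 F N θ with
    R := fun p k => (towerOfRecord₁₃SepMixed F N θ h).shadowR p k
    preservesIntegral_R := fun p k hk => (towerOfRecord₁₃SepMixed F N θ h).preservesIntegral_shadowR p k hk (avOfRecord_measurable F N p.K k)
      (avOfRecord_haarAC F N p.K k hk) (isIntegrable_towerOfRecord₁₃SepMixed F N θ h p k hk.le)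
    integrable_R := fun p k hk => (towerOfRecord₁₃SepMixed F N θ h).integrable_shadowR p k
      (isIntegrable_towerOfRecord₁₃SepMixed F N θ h p (k + 1) (Nat.succ_le_of_lt hk))
    S218 := fun p k _ => S218OfRecord₁₃ F N θ p k (densOfRecord₁₃ F N θ p k) }

/-- (v1.3 · SEPARATED (7)-REGULAR RANGE) **THE SHADOW Stage-5 parameters of `θ`** at interval letter `γ'`. [cite: Balaban1989LargeFieldI, (0.2) p.176 (bookkeeping)] -/
def shadow₅OfRecord₁₃SepMixed (θ : Stage13Params F N) (h : θ.Provisos₁₃SepMixed F N) (γ' : ℝ) : Stage5Params F N :=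
  { θ.toStage5Params with γ := γ', res := shadowResidual₁₃SepMixed F N θ h }

/-- (v1.3 · SEPARATED (7)-REGULAR RANGE) THE KEY `rfl`: the machine of the shadow has core `coreOfRecord₁₃ θ`. [cite: Balaban1988Convergent, (0.2) p.244 (bookkeeping)] -/
theorem toCore_machineOfRecord₅_shadow₁₃SepMixed (θ : Stage13Params F N) (h : θ.Provisos₁₃SepMixed F N) (γ' : ℝ) :
    (machineOfRecord₅ F N (shadow₅OfRecord₁₃SepMixed F N θ h γ')).toCore = coreOfRecord₁₃ F N θ := rfl

/-- (v1.3 · SEPARATED (7)-REGULAR RANGE) The shadow's residual `R` IS the tower's shadow operation (`rfl`). [cite: Balaban1989LargeFieldI, (0.3) p.176 (bookkeeping)] -/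
theorem res_R_shadow₁₃SepMixed (θ : Stage13Params F N) (h : θ.Provisos₁₃SepMixed F N) (γ' : ℝ) (p : B12.RunParams) (k : ℕ) :
    (shadow₅OfRecord₁₃SepMixed F N θ h γ').res.R p k = (towerOfRecord₁₃SepMixed F N θ h).shadowR p k := rfl

/-- (v1.3 · SEPARATED (7)-REGULAR RANGE) The shadow is Stage-5 admissible iff `θ`'s Stage-1 dictionary is admissible and `0 < γ'`. [cite: Balaban1989LargeFieldII, Thm 1 p.355 (bookkeeping)] -/
theorem admissible_shadow₁₃SepMixed (θ : Stage13Params F N) (h : θ.Provisos₁₃SepMixed F N) {γ' : ℝ} (hθ : θ.Admissible F N) (hγ' : 0 < γ') :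
    (shadow₅OfRecord₁₃SepMixed F N θ h γ').Admissible :=
  ⟨hθ.1.1.1.1.1.1, hγ'⟩

/-- (v1.3 · SEPARATED (7)-REGULAR RANGE) The shadow's upstream block IS the Stage-13 view's (`rfl`). [cite: Balaban1985UV3, Thm 1 p.257 (bookkeeping)] -/
theorem upOfRecord₅C_shadow₁₃SepMixed (θ : Stage13Params F N) (h : θ.Provisos₁₃SepMixed F N) (γ' : ℝ) (P : B12.RunParams) :
    upOfRecord₅C F N (shadow₅OfRecord₁₃SepMixed F N θ h γ') P = upOfRecord₅C F N (θ.toStage5₁₃ F N) P := rfl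

/-- (v1.3 · SEPARATED (7)-REGULAR RANGE) The shadow datum has the SAME CONSTRUCTION as the Stage-13 datum. [cite: Balaban1989LargeFieldII, Thm 1 + (0.1) pp.355–356 (bookkeeping)] -/
theorem datumOfRecord₅_shadow₁₃SepMixed_C (θ : Stage13Params F N) (h : θ.Provisos₁₃SepMixed F N) (γ' : ℝ) :
    (datumOfRecord₅ F N (shadow₅OfRecord₁₃SepMixed F N θ h γ')).C = (datumOfRecord₁₃SepMixed F N θ h).C :=
  datumOfRecord_C_eq_datumOfTower F N (machineOfRecord₅ F N (shadow₅OfRecord₁₃SepMixed F N θ h γ')) (towerOfRecord₁₃SepMixed F N θ h) (fun _ _ => rfl)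

/-- (v1.3 · SEPARATED (7)-REGULAR RANGE) … the same densities. [cite: Balaban1988Convergent, (0.2) p.244 (bookkeeping)] -/
theorem dens_datumOfRecord₅_shadow₁₃SepMixed (θ : Stage13Params F N) (h : θ.Provisos₁₃SepMixed F N) (γ' : ℝ) (K : ℕ) (g₀ : ℝ) (k : ℕ) :
    (datumOfRecord₅ F N (shadow₅OfRecord₁₃SepMixed F N θ h γ')).dens K g₀ k = (datumOfRecord₁₃SepMixed F N θ h).dens K g₀ k :=
  dens_datumOfRecord_eq_datumOfTower F N (machineOfRecord₅ F N (shadow₅OfRecord₁₃SepMixed F N θ h γ')) (towerOfRecord₁₃SepMixed F N θ h) (fun _ _ => rfl) K g₀ k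

/-- (v1.3 · SEPARATED (7)-REGULAR RANGE) … the same β-functions (`rfl`). [cite: Balaban1987RG1, (1.22) p.264 (bookkeeping)] -/
theorem βfun_datumOfRecord₅_shadow₁₃SepMixed (θ : Stage13Params F N) (h : θ.Provisos₁₃SepMixed F N) (γ' : ℝ) :
    (datumOfRecord₅ F N (shadow₅OfRecord₁₃SepMixed F N θ h γ')).βfun = (datumOfRecord₁₃SepMixed F N θ h).βfun := rfl

/-- (v1.3 · SEPARATED (7)-REGULAR RANGE) … and the same averaging maps (`rfl`). [cite: Balaban1987RG1, (0.4) p.253 (bookkeeping)] -/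
theorem av_datumOfRecord₅_shadow₁₃SepMixed (θ : Stage13Params F N) (h : θ.Provisos₁₃SepMixed F N) (γ' : ℝ) :
    (datumOfRecord₅ F N (shadow₅OfRecord₁₃SepMixed F N θ h γ')).av = (datumOfRecord₁₃SepMixed F N θ h).av := rfl

/-- (v1.3 · SEPARATED (7)-REGULAR RANGE) **A STAGE-13 WORLD IS A STAGE-5 RECORD AT THE SHADOW DATUM**. [cite: Balaban1989LargeFieldII, Thm 1 + (0.1) pp.355–356 (bookkeeping)] -/
theorem isRecordOfRecord₅C_shadow₁₃SepMixed (θ : Stage13Params F N) (h : θ.Provisos₁₃SepMixed F N) (hθ : θ.Admissible F N) (w : WorldP)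
    (hC : w.C = (datumOfRecord₁₃SepMixed F N θ h).C) (hγ : 0 < w.γ) (hL : w.L = (θ.L : ℝ))
    (hup : ∀ P, w.up P = upOfRecord₅C F N (θ.toStage5₁₃ F N) P) :
    IsRecordOfRecord₅C F N (datumOfRecord₅ F N (shadow₅OfRecord₁₃SepMixed F N θ h w.γ)) w :=
  isRecordOfRecord₅C_shadow F N (shadow₅OfRecord₁₃SepMixed F N θ h w.γ) (admissible_shadow₁₃SepMixed F N θ h hθ hγ) (towerOfRecord₁₃SepMixed F N θ h)
    (fun _ _ => rfl) w hC rfl hL hup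

variable {F N}

/-- (v1.3 · SEPARATED (7)-REGULAR RANGE) **REFINEMENT `IsRecordOfRecord₁₃CSepMixed → IsRecordOfRecord₅C` AT THE SHADOW**: every Stage-13 record's world is a Stage-5 record at a datum with THE SAME construction,
densities, β-functions and averaging maps. [cite: Balaban1989LargeFieldII, Thm 1 + (0.1) pp.355–356 (bookkeeping)] -/
theorem exists_isRecordOfRecord₅C_of_isRecordOfRecord₁₃CSepMixed {D : FiniteEpsData F (SU N)} {w : WorldP} (h : IsRecordOfRecord₁₃CSepMixed F N D w) :
    ∃ D₅ : FiniteEpsData F (SU N), IsRecordOfRecord₅C F N D₅ w ∧ D₅.C = D.C ∧ (∀ K g₀ k, D₅.dens K g₀ k = D.dens K g₀ k) ∧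
      D₅.βfun = D.βfun ∧ D₅.av = D.av := by
  obtain ⟨θ, hP, hθ, rfl, hC, ⟨hγ0, -⟩, hL, hup⟩ := h
  exact ⟨_, isRecordOfRecord₅C_shadow₁₃SepMixed F N θ hP hθ w hC hγ0 hL hup, datumOfRecord₅_shadow₁₃SepMixed_C F N θ hP w.γ,
    dens_datumOfRecord₅_shadow₁₃SepMixed F N θ hP w.γ, rfl, rfl⟩

/-- (v1.3 · SEPARATED (7)-REGULAR RANGE) **TRANSFER**: every node statement established over the Stage-5 record predicate in the `AtRecord` shape holds at every run of every Stage-13 record's world.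
[cite: Balaban1989LargeFieldII, Thm 1 p.355 (bookkeeping)] -/
theorem atWorld_of_isRecordOfRecord₁₃CSepMixed {X : Dag.Leaves → Prop}
    (h₅ : ∀ (D : FiniteEpsData F (SU N)) (w : WorldP), IsRecordOfRecord₅C F N D w → ∀ P : B12.RunParams, X (leavesP w P))
    {D : FiniteEpsData F (SU N)} {w : WorldP} (h : IsRecordOfRecord₁₃CSepMixed F N D w) (P : B12.RunParams) : X (leavesP w P) := by
  obtain ⟨D₅, h5, -⟩ := exists_isRecordOfRecord₅C_of_isRecordOfRecord₁₃CSepMixed h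
  exact h₅ D₅ w h5 P

section TransferredSepMixed

variable {D : FiniteEpsData F (SU N)} {w : WorldP}

/-- (v1.3 · SEPARATED (7)-REGULAR RANGE) Instance · GUARDED (0.20) at every Stage-13 record. [cite: Balaban1987RG1, (0.20) p.256] -/
theorem rgFlow_of_smallCouplings_of_isRecordOfRecord₁₃CSepMixed (h : IsRecordOfRecord₁₃CSepMixed F N D w) (P : B12.RunParams)
    (hsc : (leavesP w P).smallCouplings) : (leavesP w P).rgFlow := by
  obtain ⟨D₅, h5, -⟩ := exists_isRecordOfRecord₅C_of_isRecordOfRecord₁₃CSepMixed h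
  exact rgFlow_of_smallCouplings_of_isRecordOfRecord₅C h5 P hsc

/-- (v1.3 · SEPARATED (7)-REGULAR RANGE) Instance · N01 `Dag.B4_main` at every run of every Stage-13 record. [cite: Balaban1983RegularityDecay, Theorem p.573 (kernel version, transferred)] -/
theorem b4_main_of_isRecordOfRecord₁₃CSepMixed (h : IsRecordOfRecord₁₃CSepMixed F N D w) (P : B12.RunParams) : Dag.B4_main (leavesP w P) :=
  atWorld_of_isRecordOfRecord₁₃CSepMixed (fun _ _ h5 P => b4_main_of_isRecordOfRecord₅C h5 P) h P

/-- (v1.3 · SEPARATED (7)-REGULAR RANGE) Instance · N02 `Dag.B5_main` at every run of every Stage-13 record. [cite: Balaban1984PropagatorsI, Props. 1.1–1.2 pp.33–36 (kernel versions, transferred)] -/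
theorem b5_main_of_isRecordOfRecord₁₃CSepMixed (h : IsRecordOfRecord₁₃CSepMixed F N D w) (P : B12.RunParams) : Dag.B5_main (leavesP w P) :=
  atWorld_of_isRecordOfRecord₁₃CSepMixed (fun _ _ h5 P => b5_main_of_isRecordOfRecord₅C h5 P) h P

/-- (v1.3 · SEPARATED (7)-REGULAR RANGE) Instance · N04 `Dag.B7_main` at every run of every Stage-13 record. [cite: Balaban1985Averaging, Props. 1–10 pp.26–50 (kernel version, transferred)] -/
theorem b7_main_of_isRecordOfRecord₁₃CSepMixed (h : IsRecordOfRecord₁₃CSepMixed F N D w) (P : B12.RunParams) : Dag.B7_main (leavesP w P) :=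
  atWorld_of_isRecordOfRecord₁₃CSepMixed (fun _ _ h5 P => b7_main_of_isRecordOfRecord₅C h5 P) h P

/-- (v1.3 · SEPARATED (7)-REGULAR RANGE) Instance · the END headline at a Stage-13 record needs NO `rgFlow` binder. [cite: Balaban1989LargeFieldII, Thm 1 p.355 + p.391] -/
theorem endStatementBPrinted_of_isRecordOfRecord₁₃CSepMixed_of_nodes (h : IsRecordOfRecord₁₃CSepMixed F N D w) {γ₀ : ℝ} (hγ₀ : w.γ ≤ γ₀)
    (hnodes : ∀ P, Nodes (leavesP w P)) (hβ : BetaBoundsInInterval w.C.toB12 γ₀ w.b w.βup) :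
    B16.EndStatementBPrinted D.C := by
  obtain ⟨D₅, h5, hC5, -⟩ := exists_isRecordOfRecord₅C_of_isRecordOfRecord₁₃CSepMixed h
  rw [← hC5]
  exact endStatementBPrinted_of_isRecordOfRecord₅C_of_nodes h5 hγ₀ hnodes hβ

end TransferredSepMixed

section BetaLayerSepMixed

variable {D : FiniteEpsData F (SU N)} {w : WorldP}

variable (F N) in
/-- (v1.3 · SEPARATED (7)-REGULAR RANGE) FACE `A_{k+1}`: the core's effective action at step `k+1` IS (0.19)'s `log(𝐍_k⁻¹ · (T_k(χ_k e^{−GF∕g_k²+A_k}))(V))` with `T_k := TcanOfRecord`,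
`χ_k := chiFixed29 θ.ν θ.ε₂₉` along the ₁₃ history (`rfl`) — the VALUES this record's β reads: values of a VERSION, canonical by construction, equal to
print's point values wherever the transform's a.e.-class has a continuous representative near the point (`betaInput_eqOn_of_continuousOn₁₃`) and
nowhere asserted to be print's elsewhere. [cite: Balaban1987RG1, (0.19) p.255, p.259 (bookkeeping)] -/
theorem effAction_succ_stage13SepMixed (θ : Stage13Params F N) (h : θ.Provisos₁₃SepMixed F N) (p : B12.RunParams) (k : ℕ) (V : GaugeField (F.P p.K) (k + 1) (SU N)) :
    ((datumOfRecord₁₃SepMixed F N θ h).C p).effAction (k + 1) V =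
      Real.log ((normConstHT F N (TcanOfRecord F N) (chiFixed29 F N θ.ν θ.ε₂₉) p.K (gOfRecord₁₃ F N θ p) k)⁻¹ *
        TcanOfRecord F N p.K k (integrand (chiFixed29 F N θ.ν θ.ε₂₉ p.K (gOfRecord₁₃ F N θ p) k) (gfOfRecord F N p.K k)
          (gOfRecord₁₃ F N θ p k)
          (effActionHT F N (TcanOfRecord F N) (chiFixed29 F N θ.ν θ.ε₂₉) p.K (gOfRecord₁₃ F N θ p) k)) V) := rfl

/-- (v1.3 · SEPARATED (7)-REGULAR RANGE) **A Stage-13 record's β IS the χ-generic β at the canonical-version transport and the (2.9) species at a positive threshold `ε₂₉`** (elimination face for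
β-readers: NODE O, N24, N26). [cite: Balaban1987RG1, (1.20)–(1.22) p.264, (2.9) p.266, (0.13) p.254 (bookkeeping)] -/
theorem exists_beta_of_isRecordOfRecord₁₃CSepMixed (h : IsRecordOfRecord₁₃CSepMixed F N D w) :
    ∃ (θ : Stage13Params F N) (hP : θ.Provisos₁₃SepMixed F N), θ.Admissible F N ∧ D = datumOfRecord₁₃SepMixed F N θ hP ∧
      D.βfun = betaOfRecord₈Tχ F N (TcanOfRecord F N) (chiFixed29 F N θ.ν θ.ε₂₉) θ.toStage8Params ∧ 0 < θ.ε₂₉ := by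
  obtain ⟨θ, hP, hθ, hD, -⟩ := h
  exact ⟨θ, hP, hθ, hD, hD ▸ rfl, hθ.2⟩

end BetaLayerSepMixed

/-- **EVERY v1.2 (SEPARATED-RANGE) PROVISO SET IS A v1.3 ONE** (`bg` by monotonicity in the support set; the nine other rows verbatim; the θ-level
letters `hM` ∕ `hM₁` — `M` a power of `L`, `M₁ ∣ M`, [III] p. 245 — supplied).
[cite: Balaban1988Convergent, (2.28) p.259; Balaban1985RegularSpaces, (7) p.278 (bookkeeping)] -/
theorem Stage13Params.Provisos₁₃Sep.toSepMixed {θ : Stage13Params F N} (h : θ.Provisos₁₃Sep F N) (hM : ∃ a : ℕ, θ.τ9.M = F.L ^ a) (hM₁ : θ.ν.M₁ ∣ θ.τ9.M) : θ.Provisos₁₃SepMixed F N where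
  intPiece := h.intPiece
  measω := h.measω
  measChi := h.measChi
  zetaUnity := h.zetaUnity
  zetaAbs := h.zetaAbs
  rstep := fun p k _ hk => h.rstep p k hk
  rzLaws := h.rzLaws
  ztLaws := h.ztLaws
  ztLocal := h.ztLocal
  hM := hM
  hM₁ := hM₁
  bg := fun p n hn hw hpc => bgProvisoΛ_suppOfRecord₁₃SepMixed_of_suppOfRecord₁₃Sep (h.bg p n hn hw hpc)

/-- BRIDGE (`rfl`): along `Provisos₁₃Sep.toSepMixed` the v1.3 tower IS the v1.2 tower. [cite: Balaban1988Convergent, (0.2) p.244 (bookkeeping)] -/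
theorem towerOfRecord₁₃SepMixed_toSepMixed_sep (θ : Stage13Params F N) (h : θ.Provisos₁₃Sep F N) (hM : ∃ a : ℕ, θ.τ9.M = F.L ^ a) (hM₁ : θ.ν.M₁ ∣ θ.τ9.M) :
    towerOfRecord₁₃SepMixed F N θ (h.toSepMixed hM hM₁) = towerOfRecord₁₃Sep F N θ h := rfl

/-- BRIDGE (`rfl`): along `Provisos₁₃Sep.toSepMixed` the v1.3 datum IS the v1.2 datum — every datum of record of v1.2 is one of v1.3.
[cite: Balaban1989LargeFieldII, Thm 1 + (0.1) pp.355–356 (bookkeeping)] -/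
theorem datumOfRecord₁₃SepMixed_toSepMixed_sep (θ : Stage13Params F N) (h : θ.Provisos₁₃Sep F N) (hM : ∃ a : ℕ, θ.τ9.M = F.L ^ a) (hM₁ : θ.ν.M₁ ∣ θ.τ9.M) :
    datumOfRecord₁₃SepMixed F N θ (h.toSepMixed hM hM₁) = datumOfRecord₁₃Sep F N θ h := rfl

/-- **EVERY v1.2 RECORD IS A v1.3 RECORD, GIVEN THE PINS `M = L^a`, `M₁ ∣ M` ON v1.2 CARRIERS** (along `Provisos₁₃Sep.toSepMixed`, same datum by `rfl`).
[cite: Balaban1989LargeFieldII, Thm 1 + (0.1) pp.355–356 (bookkeeping)] -/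
theorem IsRecordOfRecord₁₃CSep.toSepMixed {D : FiniteEpsData F (SU N)} {w : WorldP} (h : IsRecordOfRecord₁₃CSep F N D w)
    (hM : ∀ θ : Stage13Params F N, θ.Provisos₁₃Sep F N → (∃ a : ℕ, θ.τ9.M = F.L ^ a) ∧ θ.ν.M₁ ∣ θ.τ9.M) :
    IsRecordOfRecord₁₃CSepMixed F N D w := by
  obtain ⟨θ, hP, hθ, hD, hC, hγ, hL, hup⟩ := h
  exact ⟨θ, hP.toSepMixed (hM θ hP).1 (hM θ hP).2, hθ, hD, hC, hγ, hL, hup⟩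

/-- **EVERY v1.2 RECORD WITH THE PINS `M = L^a`, `M₁ ∣ M` IS A v1.3 RECORD** (pointed form, along `Provisos₁₃Sep.toSepMixed`, same datum by `rfl`).
[cite: Balaban1989LargeFieldII, Thm 1 + (0.1) pp.355–356; Balaban1988Convergent, p.245 (bookkeeping)] -/
theorem isRecordOfRecord₁₃CSepMixed_of_sep (θ : Stage13Params F N) (h : θ.Provisos₁₃Sep F N) (hM : ∃ a : ℕ, θ.τ9.M = F.L ^ a) (hM₁ : θ.ν.M₁ ∣ θ.τ9.M)
    (hθ : θ.Admissible F N) (w : WorldP) (hC : w.C = (datumOfRecord₁₃Sep F N θ h).C) (hγ : 0 < w.γ ∧ w.γ ≤ θ.γ) (hL : w.L = (θ.L : ℝ))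
    (hup : ∀ P, w.up P = upOfRecord₅C F N (θ.toStage5₁₃ F N) P) :
    IsRecordOfRecord₁₃CSepMixed F N (datumOfRecord₁₃Sep F N θ h) w :=
  ⟨θ, h.toSepMixed hM hM₁, hθ, rfl, hC, hγ, hL, hup⟩

end MixedRange

end Literature.MathematicalPhysics.QuantumFieldTheory.Balaban1983to89.Node00

end
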